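import Mathlib.NumberTheory.LSeries.RiemannZeta
import Mathlib.NumberTheory.Harmonic.ZetaAsymp
import Mathlib.NumberTheory.Harmonic.Bounds
import Mathlib.Analysis.Real.Pi.Bounds
import Mathlib.Analysis.SpecialFunctions.Pow.Deriv
import Mathlib.Analysis.SpecialFunctions.Trigonometric.Bounds
import Mathlib.Analysis.Calculus.MeanValue
import Mathlib.Analysis.SpecificLimits.Basic
import Mathlib.Algebra.Order.Chebyshev
import Mathlib.Algebra.Order.Interval.Finset.Basic
import HarnessLib

/-!
# Van der Corput's method and `ζ(σ + it) = o(log t)` on `1 < σ ≤ 2`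

Topic `Literature/NumberTheory/LFunctions`. Everything in this file is PROVED (no `sorry`, no named
facts). It supplies the only piece of "Vinogradov–Korobov type" input that the deduction of the
logarithmically averaged Chowla conjecture (Tao 2016, Thm 1.2) from the log-averaged Elliott
theorem (Tao 2016, Thm 1.3) needs, namely that the Liouville function does not pretend to be
`χ(n) n^{it}`, `|t| ≤ A x` (`Literature/NumberTheory/LFunctions/LiouvilleNonpretentious.lean`):
for that purpose an upper bound `|ζ(1 + 1/log x + iu)| = o(log x)` uniformly in `2 ≤ |u| ≤ x²`
suffices, and this file proves it by van der Corput's method of exponential sums, following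
Graham–Kolesnik, *Van der Corput's Method of Exponential Sums* (1991), Ch. 2.

Main results (namespace `Literature.VdC`):
* `Literature.NumberTheory.LFunctions.VdC.kusminLandau` — the (discrete) Kusmin–Landau inequality (G–K Thm 2.1, §2.6):
  if the increments `θ(n) = φ(n+1) - φ(n)` are nondecreasing and stay in `[ν + δ, ν + 1 - δ]`
  then `‖∑ e(φ(n))‖ ≤ 2/δ`.
* `Literature.NumberTheory.LFunctions.VdC.secondDerivTest` — van der Corput's second derivative test (G–K Thm 2.2):
  `λ ≤ f'' ≤ hλ` on `[a, b]` implies `‖∑_{a<n≤b} e(f(n))‖ ≤ 12 (h (b-a) λ^{1/2} + λ^{-1/2})`.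
* `Literature.NumberTheory.LFunctions.VdC.vanDerCorput_ineq`, `Literature.NumberTheory.LFunctions.VdC.vanDerCorput_e` — the Weyl–van der Corput inequality
  (G–K Lemma 2.5 and eq. (2.3.4)).
* `Literature.NumberTheory.LFunctions.VdC.kth_deriv_test` — a `k`-th derivative test for every `k ≥ 2` in the weak form
  `‖∑ e(f(n))‖ ≤ C_k ((b-a) λ^{α_k} + (b-a)^{1-β_k} λ^{-β_k/2})` for `λ ≤ f^{(k)} ≤ hλ`, with some
  `0 < α_k, β_k ≤ 1` (obtained from the second derivative test by `k - 2` Weyl–van der Corput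
  differencings; cf. G–K Thm 2.8, Titchmarsh Thm 5.13, where the exponents are explicit).
* `Literature.NumberTheory.LFunctions.VdC.powerSaving` — for every `K` a power saving `‖∑_{N<n≤x} n^{-iu}‖ ≤ C N^{1-δ}`,
  `N < x ≤ 2N`, uniformly in `√N ≤ u ≤ N^{K+1/2}`.
* `Literature.NumberTheory.LFunctions.VdC.norm_zeta_sub_sum_le` — `‖ζ(s) - ∑_{n ≤ U} n^{-s}‖ ≤ 3` for `1 < Re s ≤ 2`,
  `Im s ≥ 2`, `U ≥ 2 Im s` (elementary comparison with `∫ y^{-s} dy`).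
* `Literature.NumberTheory.LFunctions.VdC.norm_zeta_le_log_div`, `Literature.NumberTheory.LFunctions.VdC.norm_zeta_le_log_div_abs` — **for every `K ≥ 1` there
  is `C` with `‖ζ(σ + iu)‖ ≤ (log |u|)/K + C` for all `1 < σ ≤ 2`, `|u| ≥ 2`**; i.e.
  `ζ(σ + it) = o(log t)` uniformly for `1 < σ ≤ 2` (a weak form of the classical
  `ζ(1 + it) ≪ log t / log log t`, G–K Thm 2.14, Titchmarsh Thm 5.16).

## References
* S. W. Graham, G. Kolesnik, *Van der Corput's Method of Exponential Sums*, London Math. Soc.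
  Lecture Note Series 126, Cambridge University Press 1991, Ch. 2 (Thm 2.1, Thm 2.2, Lemma 2.5,
  (2.3.4), Thm 2.8, Lemmas 2.10–2.11, Thm 2.14).
* E. C. Titchmarsh, *The Theory of the Riemann Zeta-Function*, 2nd ed. (rev. D. R. Heath-Brown),
  Oxford 1986, §§5.9–5.16.

## Design choices
* Exponential sums are over `Finset.Ioc a b` with `a b : ℤ` and `e(x) = exp(2πix)`
  (`Literature.NumberTheory.LFunctions.VdC.e`); phases are functions `ℝ → ℝ` evaluated at integer points.
* Higher derivatives are handled through explicit *derivative families* `D : ℕ → ℝ → ℝ` with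
  `HasDerivAt (D j) (D (j+1) y) y` on `[a, b]` (`Literature.NumberTheory.LFunctions.VdC.DerivFamily`), which avoids `iteratedDeriv`
  and makes Weyl differencing (`D j (y + d) - D j y`) formal bookkeeping.
* All constants are existential; the exponents `α_k, β_k` of the `k`-th derivative test are only
  asserted to lie in `(0, 1]`, which is all the application needs (any power saving in each range
  `N^{k-3/2} ≤ u ≤ N^{k-1/2}`).
* No result of this file is stated stronger than what is proved; the tags `[cite: …]` on proved
  theorems point to the corresponding (often sharper) statements in Graham–Kolesnik.
-/

open Finset Real

/-! ## Part 1: `e(x)` and the discrete Kusmin–Landau inequality -/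

open Finset Real

namespace Literature.NumberTheory.LFunctions
namespace VdC

/-- `e(x) = exp(2π i x)`. [folklore] -/
noncomputable def e (x : ℝ) : ℂ := Complex.exp (((2 * π * x : ℝ) : ℂ) * Complex.I)

/-- `|e(x)| = 1`. [folklore] -/
theorem norm_e (x : ℝ) : ‖e x‖ = 1 := by
  unfold e
  exact Complex.norm_exp_ofReal_mul_I _

/-- `e(x + y) = e(x) e(y)`. [folklore] -/
theorem e_add (x y : ℝ) : e (x + y) = e x * e y := by
  unfold e
  rw [← Complex.exp_add]
  congr 1
  push_cast
  ring

/-- `e(n) = 1` for integers `n`. [folklore] -/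
theorem e_int (n : ℤ) : e n = 1 := by
  unfold e
  have : ((2 * π * (n : ℝ) : ℝ) : ℂ) * Complex.I = n * (2 * π * Complex.I) := by
    push_cast; ring
  rw [this]
  exact Complex.exp_int_mul_two_pi_mul_I n

/-- `e(x - n) = e(x)` for integers `n`. [folklore] -/
theorem e_sub_int (x : ℝ) (n : ℤ) : e (x - n) = e x := by
  have := e_add (x - n) n
  rw [sub_add_cancel, e_int, mul_one] at this
  exact this.symm

/-- `e(x + n) = e(x)` for integers `n`. [folklore] -/
theorem e_add_int (x : ℝ) (n : ℤ) : e (x + n) = e x := by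
  rw [e_add, e_int, mul_one]

/-- `e(-x) = conj e(x)`. [folklore] -/
theorem e_neg (x : ℝ) : e (-x) = (starRingEnd ℂ) (e x) := by
  unfold e
  rw [← Complex.exp_conj]
  congr 1
  simp only [map_mul, Complex.conj_ofReal, Complex.conj_I]
  push_cast
  ring

/-- `e(0) = 1`. [folklore] -/
theorem e_zero : e 0 = 1 := by
  simpa using e_int 0

/-- `e(x - y) = e(x) conj e(y)`. [folklore] -/
theorem e_sub (x y : ℝ) : e (x - y) = e x * (starRingEnd ℂ) (e y) := by
  rw [sub_eq_add_neg, e_add, e_neg]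

/-- `cot(πx)`. [folklore] -/
noncomputable def cotπ (x : ℝ) : ℝ := Real.cos (π * x) / Real.sin (π * x)

/-- `e(x) - 1 = 2 sin(πx) (-sin(πx) + i cos(πx))`. [folklore] -/
theorem e_sub_one_eq (x : ℝ) :
    e x - 1 = 2 * (Real.sin (π * x) : ℂ) *
      (-(Real.sin (π * x) : ℂ) + (Real.cos (π * x) : ℂ) * Complex.I) := by
  unfold e
  rw [Complex.exp_mul_I, ← Complex.ofReal_cos, ← Complex.ofReal_sin]
  have h1 : Real.cos (2 * π * x) = 2 * Real.cos (π * x) ^ 2 - 1 := by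
    rw [show 2 * π * x = 2 * (π * x) by ring, Real.cos_two_mul]
  have h2 : Real.sin (2 * π * x) = 2 * Real.sin (π * x) * Real.cos (π * x) := by
    rw [show 2 * π * x = 2 * (π * x) by ring, Real.sin_two_mul]
  have h3 := Real.sin_sq_add_cos_sq (π * x)
  rw [h1, h2]
  have h4 : (2 : ℝ) * Real.cos (π * x) ^ 2 - 1 = 1 - 2 * Real.sin (π * x) ^ 2 := by linarith
  rw [h4]
  push_cast
  ring

/-- The Kusmin–Landau coefficient `c(x) = 1/(e(x) - 1) = -1/2 - (i/2) cot(πx)`. [folklore] -/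
noncomputable def cKL (x : ℝ) : ℂ :=
  -1 / 2 - Complex.I / 2 * ((cotπ x : ℝ) : ℂ)

/-- `c(x) = (-sin(πx) - i cos(πx)) / (2 sin(πx))` when `sin(πx) ≠ 0`. [folklore] -/
theorem cKL_eq {x : ℝ} (hx : Real.sin (π * x) ≠ 0) :
    cKL x = (-(Real.sin (π * x) : ℂ) - Complex.I * (Real.cos (π * x) : ℂ))
      / (2 * (Real.sin (π * x) : ℂ)) := by
  have hs : (Real.sin (π * x) : ℂ) ≠ 0 := Complex.ofReal_ne_zero.2 hx
  unfold cKL cotπ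
  rw [Complex.ofReal_div]
  field_simp

/-- The defining property `c(x) (e(x) - 1) = 1` when `sin(πx) ≠ 0`. [folklore] -/
theorem cKL_mul_e_sub_one {x : ℝ} (hx : Real.sin (π * x) ≠ 0) : cKL x * (e x - 1) = 1 := by
  rw [e_sub_one_eq, cKL_eq hx]
  set s : ℝ := Real.sin (π * x) with hs_def
  set c : ℝ := Real.cos (π * x) with hc_def
  have hs : (s : ℂ) ≠ 0 := Complex.ofReal_ne_zero.2 hx
  have h3 : s ^ 2 + c ^ 2 = 1 := Real.sin_sq_add_cos_sq (π * x)
  have h3' : (s : ℂ) ^ 2 + (c : ℂ) ^ 2 = 1 := by exact_mod_cast h3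
  have hI : Complex.I * Complex.I = -1 := Complex.I_mul_I
  have key : (-(s : ℂ) - Complex.I * c) * (-(s : ℂ) + c * Complex.I) = 1 := by
    linear_combination h3' - ((c : ℂ) ^ 2) * hI
  have h2s : (2 : ℂ) * s ≠ 0 := mul_ne_zero two_ne_zero hs
  calc (-(s : ℂ) - Complex.I * c) / (2 * s) * (2 * (s : ℂ) * (-(s : ℂ) + (c : ℂ) * Complex.I))
      = ((-(s : ℂ) - Complex.I * c) * (-(s : ℂ) + c * Complex.I)) * ((2 * s) / (2 * s)) := by ring
    _ = 1 := by rw [key, div_self h2s, one_mul]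

/-- `‖c(x)‖ ≤ 1/2 + |cot(πx)|/2`. [folklore] -/
theorem norm_cKL_le (x : ℝ) : ‖cKL x‖ ≤ 1 / 2 + |cotπ x| / 2 := by
  unfold cKL
  refine (norm_sub_le _ _).trans (le_of_eq ?_)
  have h1 : ‖(-1 / 2 : ℂ)‖ = 1 / 2 := by
    rw [norm_div, norm_neg, norm_one, Complex.norm_two]
  have h2 : ‖Complex.I / 2 * ((cotπ x : ℝ) : ℂ)‖ = |cotπ x| / 2 := by
    rw [norm_mul, norm_div, Complex.norm_I, Complex.norm_two, Complex.norm_real,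
      Real.norm_eq_abs]
    ring
  rw [h1, h2]

/-- `‖c(x) - c(y)‖ = |cot(πy) - cot(πx)| / 2`. [folklore] -/
theorem norm_cKL_sub_cKL (x y : ℝ) : ‖cKL x - cKL y‖ = |cotπ y - cotπ x| / 2 := by
  have : cKL x - cKL y = Complex.I / 2 * ((cotπ y - cotπ x : ℝ) : ℂ) := by
    unfold cKL; push_cast; ring
  rw [this, norm_mul, norm_div, Complex.norm_I, Complex.norm_two, Complex.norm_real,
    Real.norm_eq_abs]
  ring

/-- `sin(πx) ≥ 2δ` for `x ∈ [δ, 1-δ]`, `0 < δ` (Jordan's inequality). [folklore] -/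
theorem two_mul_le_sin_pi_mul {x δ : ℝ} (hδ : 0 < δ) (h1 : δ ≤ x) (h2 : x ≤ 1 - δ) :
    2 * δ ≤ Real.sin (π * x) := by
  have hπ := Real.pi_pos
  rcases le_or_gt x (1 / 2) with hx | hx
  · have hj := Real.mul_le_sin (x := π * x) (mul_nonneg hπ.le (by linarith)) (by nlinarith)
    calc 2 * δ ≤ 2 * x := by linarith
      _ = 2 / π * (π * x) := by field_simp
      _ ≤ Real.sin (π * x) := hj
  · rw [← Real.sin_pi_sub, show π - π * x = π * (1 - x) by ring]
    have hj := Real.mul_le_sin (x := π * (1 - x)) (by nlinarith) (by nlinarith)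
    calc 2 * δ ≤ 2 * (1 - x) := by linarith
      _ = 2 / π * (π * (1 - x)) := by field_simp
      _ ≤ Real.sin (π * (1 - x)) := hj

/-- `sin(πx) > 0` for `x ∈ [δ, 1-δ]`, `δ > 0`. [folklore] -/
theorem sin_pi_mul_pos {x δ : ℝ} (hδ : 0 < δ) (h1 : δ ≤ x) (h2 : x ≤ 1 - δ) :
    0 < Real.sin (π * x) := by
  have := two_mul_le_sin_pi_mul hδ h1 h2
  linarith

/-- `|cot(πx)| ≤ 1/(2δ)` for `x ∈ [δ, 1-δ]`. [folklore] -/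
theorem abs_cot_le {x δ : ℝ} (hδ : 0 < δ) (h1 : δ ≤ x) (h2 : x ≤ 1 - δ) :
    |cotπ x| ≤ 1 / (2 * δ) := by
  have hs := two_mul_le_sin_pi_mul hδ h1 h2
  have hs0 : 0 < Real.sin (π * x) := by linarith
  unfold cotπ
  rw [abs_div, abs_of_pos hs0, div_le_div_iff₀ hs0 (by positivity)]
  calc |Real.cos (π * x)| * (2 * δ) ≤ 1 * (2 * δ) := by
        gcongr; exact Real.abs_cos_le_one _
    _ = 2 * δ := one_mul _
    _ ≤ 1 * Real.sin (π * x) := by linarith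

/-- `cot(π ·)` is nonincreasing on `[δ, 1-δ]`. [folklore] -/
theorem cot_anti {x y δ : ℝ} (hδ : 0 < δ) (hx1 : δ ≤ x) (hy2 : y ≤ 1 - δ) (hxy : x ≤ y) :
    cotπ y ≤ cotπ x := by
  have hx2 : x ≤ 1 - δ := hxy.trans hy2
  have hy1 : δ ≤ y := hx1.trans hxy
  have hsx := sin_pi_mul_pos hδ hx1 hx2
  have hsy := sin_pi_mul_pos hδ hy1 hy2
  unfold cotπ
  rw [div_le_div_iff₀ hsy hsx, ← sub_nonneg]
  have : Real.cos (π * x) * Real.sin (π * y) - Real.cos (π * y) * Real.sin (π * x)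
      = Real.sin (π * y - π * x) := by
    rw [Real.sin_sub]; ring
  rw [this]
  apply Real.sin_nonneg_of_nonneg_of_le_pi
  · nlinarith [Real.pi_pos]
  · nlinarith [Real.pi_pos]

/-- Abel summation in the form used for Kusmin–Landau: if `z i = c i * (z (i+1) - z i)` for
`i < L`, `1 ≤ L`, then `∑_{i<L} z i = c (L-1) z L - c 0 z 0 + ∑_{1 ≤ i < L} (c (i-1) - c i) z i`.
[folklore] -/
theorem abel_KL (z c : ℕ → ℂ) (L : ℕ) (hL : 1 ≤ L)
    (h : ∀ i, i < L → z i = c i * (z (i + 1) - z i)) :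
    ∑ i ∈ range L, z i
      = c (L - 1) * z L - c 0 * z 0 + ∑ i ∈ Ico 1 L, (c (i - 1) - c i) * z i := by
  induction L, hL using Nat.le_induction with
  | base =>
    simp only [range_one, sum_singleton, Nat.sub_self, Ico_self, sum_empty, add_zero]
    linear_combination h 0 (by norm_num)
  | succ L hL ih =>
    rw [sum_range_succ, ih (fun i hi => h i (Nat.lt_succ_of_lt hi)), Nat.add_sub_cancel,
      sum_Ico_succ_top hL]
    linear_combination h L (Nat.lt_succ_self L)

/-- **Discrete Kusmin–Landau inequality** (Graham–Kolesnik Thm 2.1; §2.6). Let `φ : ℤ → ℝ`,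
`θ(n) = φ(n+1) - φ(n)`. If on `m ≤ n < M` we have `ν + δ ≤ θ(n) ≤ ν + 1 - δ` for an integer `ν` and
`0 < δ ≤ 1/2`, and `θ` is nondecreasing there, then `‖∑_{n=m}^{M} e(φ(n))‖ ≤ 2/δ`.
[cite: GrahamKolesnik1991, Thm 2.1 and §2.6 Notes (discrete form, van der Corput 1921/Kusmin 1927/Landau 1928)] -/
theorem kusminLandau {φ : ℤ → ℝ} {m M ν : ℤ} {δ : ℝ} (hδ : 0 < δ) (hδ2 : δ ≤ 1 / 2)
    (hθ : ∀ n : ℤ, m ≤ n → n < M →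
      (ν : ℝ) + δ ≤ φ (n + 1) - φ n ∧ φ (n + 1) - φ n ≤ ν + 1 - δ)
    (hmono : ∀ n : ℤ, m ≤ n → n + 1 < M → φ (n + 1) - φ n ≤ φ (n + 2) - φ (n + 1)) :
    ‖∑ n ∈ Finset.Icc m M, e (φ n)‖ ≤ 2 / δ := by
  have h2δ : (2 : ℝ) ≤ 1 / δ := by
    rw [le_div_iff₀ hδ]; linarith
  have h2δ' : (2 : ℝ) / δ = 2 * (1 / δ) := by ring
  rcases lt_or_ge M m with hMm | hMm
  · rw [Finset.Icc_eq_empty (not_le.2 hMm), sum_empty, norm_zero]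
    positivity
  -- reindex: n = m + i, i ∈ range (L+1)
  obtain ⟨L, rfl⟩ : ∃ L : ℕ, M = m + L := ⟨(M - m).toNat, by omega⟩
  set z : ℕ → ℂ := fun i => e (φ (m + i)) with hz
  set θ' : ℕ → ℝ := fun i => φ (m + i + 1) - φ (m + i) - ν with hθ'
  set c : ℕ → ℂ := fun i => cKL (θ' i) with hc
  have hinj : ∀ i ∈ range (L + 1), ∀ j ∈ range (L + 1), m + (i : ℤ) = m + (j : ℤ) → i = j := by
    intro i _ j _ hij
    exact_mod_cast (add_left_cancel hij)
  have hsum : ∑ n ∈ Finset.Icc m (m + L), e (φ n) = ∑ i ∈ range (L + 1), z i := by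
    have hI : Finset.Icc m (m + L) = (range (L + 1)).image (fun i : ℕ => m + (i : ℤ)) := by
      ext n
      simp only [Finset.mem_Icc, Finset.mem_image, Finset.mem_range]
      constructor
      · rintro ⟨h1, h2⟩
        exact ⟨(n - m).toNat, by omega, by omega⟩
      · rintro ⟨i, hi, rfl⟩
        omega
    rw [hI, Finset.sum_image hinj]
  rw [hsum]
  -- properties of θ'
  have hθ'1 : ∀ i, i < L → δ ≤ θ' i ∧ θ' i ≤ 1 - δ := by
    intro i hi
    have := hθ (m + i) (by omega) (by omega)
    simp only [hθ']
    constructor <;> linarith [this.1, this.2]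
  have hθ'mono : ∀ i, i + 1 < L → θ' i ≤ θ' (i + 1) := by
    intro i hi
    have := hmono (m + i) (by omega) (by omega)
    simp only [hθ']
    push_cast
    have e1 : m + ((i : ℤ) + 1) + 1 = m + i + 2 := by ring
    have e2 : m + ((i : ℤ) + 1) = m + i + 1 := by ring
    rw [e1, e2]
    linarith
  -- the recursion z i = c i * (z (i+1) - z i)
  have hrec : ∀ i, i < L → z i = c i * (z (i + 1) - z i) := by
    intro i hi
    have hs : Real.sin (π * θ' i) ≠ 0 :=
      (sin_pi_mul_pos hδ (hθ'1 i hi).1 (hθ'1 i hi).2).ne'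
    have hstep : z (i + 1) = z i * e (θ' i) := by
      simp only [hz, hθ']
      rw [← e_add]
      have e3 : m + ((i + 1 : ℕ) : ℤ) = m + i + 1 := by push_cast; ring
      rw [e3]
      have : φ (m + i) + (φ (m + i + 1) - φ (m + i) - ν) = φ (m + i + 1) - (ν : ℝ) := by ring
      rw [this, e_sub_int]
    have key : c i * (e (θ' i) - 1) = 1 := cKL_mul_e_sub_one hs
    rw [hstep]
    linear_combination (-(z i)) * key
  -- norms
  have hz1 : ∀ i, ‖z i‖ = 1 := fun i => norm_e _
  have hcn : ∀ i, i < L → ‖c i‖ ≤ 1 / 2 + 1 / (4 * δ) := by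
    intro i hi
    refine (norm_cKL_le _).trans ?_
    have := abs_cot_le hδ (hθ'1 i hi).1 (hθ'1 i hi).2
    calc 1 / 2 + |cotπ (θ' i)| / 2 ≤ 1 / 2 + (1 / (2 * δ)) / 2 := by gcongr
      _ = 1 / 2 + 1 / (4 * δ) := by ring
  rcases Nat.eq_zero_or_pos L with hL0 | hLpos
  · subst hL0
    rw [zero_add, Finset.sum_range_one, hz1]
    linarith
  rw [sum_range_succ, abel_KL z c L hLpos hrec]
  -- telescoping bound for the middle sum
  have hmid : ∀ K, 1 ≤ K → K ≤ L →
      ∑ i ∈ Ico 1 K, ‖(c (i - 1) - c i) * z i‖ ≤ (cotπ (θ' 0) - cotπ (θ' (K - 1))) / 2 := by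
    intro K hK hKL
    induction K, hK using Nat.le_induction with
    | base => simp
    | succ K hK ih =>
      rw [sum_Ico_succ_top hK, Nat.add_sub_cancel]
      have ih' := ih (Nat.le_of_succ_le hKL)
      have hKm : K - 1 + 1 = K := Nat.sub_add_cancel hK
      have hmono' : θ' (K - 1) ≤ θ' K := by
        have := hθ'mono (K - 1) (by omega)
        rwa [hKm] at this
      have hanti : cotπ (θ' K) ≤ cotπ (θ' (K - 1)) :=
        cot_anti hδ (hθ'1 (K-1) (by omega)).1 (hθ'1 K (by omega)).2 hmono'
      have hterm : ‖(c (K - 1) - c K) * z K‖ = (cotπ (θ' (K - 1)) - cotπ (θ' K)) / 2 := by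
        rw [norm_mul, hz1, mul_one]
        show ‖cKL (θ' (K - 1)) - cKL (θ' K)‖ = _
        rw [norm_cKL_sub_cKL, abs_of_nonpos (by linarith)]
        ring
      rw [hterm]
      linarith
  have hmidL := hmid L hLpos le_rfl
  have hcot0 : |cotπ (θ' 0)| ≤ 1 / (2 * δ) := abs_cot_le hδ (hθ'1 0 hLpos).1 (hθ'1 0 hLpos).2
  have hcotL : |cotπ (θ' (L - 1))| ≤ 1 / (2 * δ) :=
    abs_cot_le hδ (hθ'1 (L-1) (by omega)).1 (hθ'1 (L-1) (by omega)).2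
  have hA : ‖∑ i ∈ Ico 1 L, (c (i - 1) - c i) * z i‖ ≤ 1 / (2 * δ) := by
    refine (norm_sum_le _ _).trans (hmidL.trans ?_)
    have h1 := (abs_le.1 hcot0).2
    have h2 := (abs_le.1 hcotL).1
    linarith
  have hB : ‖c (L - 1) * z L‖ ≤ 1 / 2 + 1 / (4 * δ) := by
    rw [norm_mul, hz1, mul_one]; exact hcn _ (by omega)
  have hC : ‖c 0 * z 0‖ ≤ 1 / 2 + 1 / (4 * δ) := by
    rw [norm_mul, hz1, mul_one]; exact hcn _ hLpos
  calc ‖c (L - 1) * z L - c 0 * z 0 + ∑ i ∈ Ico 1 L, (c (i - 1) - c i) * z i + z L‖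
      ≤ ‖c (L - 1) * z L‖ + ‖c 0 * z 0‖ + ‖∑ i ∈ Ico 1 L, (c (i - 1) - c i) * z i‖ + ‖z L‖ := by
        refine (norm_add_le _ _).trans ?_
        gcongr
        refine (norm_add_le _ _).trans ?_
        gcongr
        exact norm_sub_le _ _
    _ ≤ (1 / 2 + 1 / (4 * δ)) + (1 / 2 + 1 / (4 * δ)) + 1 / (2 * δ) + 1 := by
        rw [hz1]; gcongr
    _ = 2 + 1 / δ := by field_simp; ring
    _ ≤ 2 / δ := by rw [h2δ']; linarith

end VdC
end Literature.NumberTheory.LFunctions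

/-! ## Part 2: the second derivative test (Graham–Kolesnik Thm 2.2) -/

namespace Literature.NumberTheory.LFunctions
namespace VdC

open Finset Real

/-- Trivial bound `‖∑_{n ∈ T} e(φ n)‖ ≤ #T`. [folklore] -/
theorem norm_sum_e_le_card (T : Finset ℤ) (φ : ℤ → ℝ) : ‖∑ n ∈ T, e (φ n)‖ ≤ T.card := by
  refine (norm_sum_le _ _).trans ?_
  simp [norm_e]

/-- A finite set of integers of diameter `≤ R` has at most `R + 1` elements. [folklore] -/
theorem card_le_of_diam {T : Finset ℤ} {R : ℝ} (hR : 0 ≤ R)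
    (h : ∀ n₁ ∈ T, ∀ n₂ ∈ T, n₁ ≤ n₂ → ((n₂ : ℤ) : ℝ) - n₁ ≤ R) : (T.card : ℝ) ≤ R + 1 := by
  rcases T.eq_empty_or_nonempty with rfl | hne
  · simp; linarith
  · have hsub : T ⊆ Finset.Icc (T.min' hne) (T.max' hne) := fun n hn =>
      Finset.mem_Icc.2 ⟨T.min'_le n hn, T.le_max' n hn⟩
    have hmM : T.min' hne ≤ T.max' hne := T.min'_le _ (T.max'_mem hne)
    have h1 := h _ (T.min'_mem hne) _ (T.max'_mem hne) hmM
    have h0 : 0 ≤ T.max' hne + 1 - T.min' hne := by linarith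
    have hc : ((Finset.Icc (T.min' hne) (T.max' hne)).card : ℤ) = T.max' hne + 1 - T.min' hne := by
      rw [Int.card_Icc, Int.toNat_of_nonneg h0]
    have hc' : ((Finset.Icc (T.min' hne) (T.max' hne)).card : ℝ)
        = ((T.max' hne : ℤ) : ℝ) + 1 - ((T.min' hne : ℤ) : ℝ) := by
      exact_mod_cast hc
    calc (T.card : ℝ) ≤ ((Finset.Icc (T.min' hne) (T.max' hne)).card : ℝ) := by
          exact_mod_cast Finset.card_le_card hsub
      _ = ((T.max' hne : ℤ) : ℝ) + 1 - ((T.min' hne : ℤ) : ℝ) := hc'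
      _ ≤ R + 1 := by linarith

/-- A nonempty finite set of integers closed under betweenness is an interval. [folklore] -/
theorem eq_Icc_of_between {T : Finset ℤ} (hne : T.Nonempty)
    (h : ∀ n₁ ∈ T, ∀ n₂ ∈ T, ∀ n, n₁ ≤ n → n ≤ n₂ → n ∈ T) :
    T = Finset.Icc (T.min' hne) (T.max' hne) := by
  ext n
  constructor
  · intro hn; exact Finset.mem_Icc.2 ⟨T.min'_le n hn, T.le_max' n hn⟩
  · intro hn
    rw [Finset.mem_Icc] at hn
    exact h _ (T.min'_mem hne) _ (T.max'_mem hne) n hn.1 hn.2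

/-- Mean value theorem on `[n, n+1]` for a function differentiable on `[a, b] ⊇ [n, n+1]`.
[folklore] -/
theorem exists_deriv_eq_step {f f' : ℝ → ℝ} {a b : ℝ}
    (hf : ∀ y ∈ Set.Icc a b, HasDerivAt f (f' y) y) {n : ℝ} (h1 : a ≤ n) (h2 : n + 1 ≤ b) :
    ∃ ξ : ℝ, n < ξ ∧ ξ < n + 1 ∧ f' ξ = f (n + 1) - f n := by
  have hsub : Set.Icc n (n + 1) ⊆ Set.Icc a b := Set.Icc_subset_Icc h1 h2
  obtain ⟨ξ, hξ, hξ'⟩ := exists_hasDerivAt_eq_slope f f' (by linarith : n < n + 1)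
    (fun y hy => (hf y (hsub hy)).continuousAt.continuousWithinAt)
    (fun y hy => hf y (hsub (Set.Ioo_subset_Icc_self hy)))
  refine ⟨ξ, hξ.1, hξ.2, ?_⟩
  rw [hξ']
  have : n + 1 - n = (1 : ℝ) := by ring
  rw [this, div_one]

/-- The hypotheses of the second derivative test: `f` differentiable on `[a, b]` with
`λ (y₂ - y₁) ≤ f'(y₂) - f'(y₁) ≤ h λ (y₂ - y₁)` for `a ≤ y₁ ≤ y₂ ≤ b`. [folklore] -/
structure SecondDerivHyp (f f' : ℝ → ℝ) (a b lam h : ℝ) : Prop where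
  hasDeriv : ∀ y ∈ Set.Icc a b, HasDerivAt f (f' y) y
  incr : ∀ y₁ ∈ Set.Icc a b, ∀ y₂ ∈ Set.Icc a b, y₁ ≤ y₂ →
    lam * (y₂ - y₁) ≤ f' y₂ - f' y₁ ∧ f' y₂ - f' y₁ ≤ h * lam * (y₂ - y₁)

namespace SecondDerivHyp

variable {f f' : ℝ → ℝ} {a b lam h : ℝ}

/-- `f'` is nondecreasing under `SecondDerivHyp` with `λ > 0`. [folklore] -/
theorem mono (H : SecondDerivHyp f f' a b lam h) (hlam : 0 < lam)
    {y₁ y₂ : ℝ} (h1 : y₁ ∈ Set.Icc a b) (h2 : y₂ ∈ Set.Icc a b) (h12 : y₁ ≤ y₂) :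
    f' y₁ ≤ f' y₂ := by
  have := (H.incr y₁ h1 y₂ h2 h12).1
  have h0 : 0 ≤ lam * (y₂ - y₁) := mul_nonneg hlam.le (by linarith)
  linarith

/-- Kusmin–Landau on an integer interval `[m, M] ⊆ [a, b]` on which `ν + δ ≤ f' ≤ ν + 1 - δ`.
[folklore] -/
theorem kl_interval (H : SecondDerivHyp f f' a b lam h) (hlam : 0 < lam) {m M ν : ℤ} {δ : ℝ}
    (hδ : 0 < δ) (hδ2 : δ ≤ 1 / 2) (ham : a ≤ m) (hMb : (M : ℝ) ≤ b)
    (hm : (ν : ℝ) + δ ≤ f' m) (hM : f' M ≤ ν + 1 - δ) :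
    ‖∑ n ∈ Finset.Icc m M, e (f n)‖ ≤ 2 / δ := by
  rcases lt_or_ge M m with hMm | hmM
  · rw [Finset.Icc_eq_empty (not_le.2 hMm), sum_empty, norm_zero]; positivity
  have hmM' : ((m : ℤ) : ℝ) ≤ M := by exact_mod_cast hmM
  have hmI : ((m : ℤ) : ℝ) ∈ Set.Icc a b := ⟨ham, hmM'.trans hMb⟩
  have hMI : ((M : ℤ) : ℝ) ∈ Set.Icc a b := ⟨ham.trans hmM', hMb⟩
  have hstep : ∀ n : ℤ, m ≤ n → n + 1 ≤ M →
      ∃ ξ : ℝ, (n : ℝ) < ξ ∧ ξ < n + 1 ∧ f' ξ = f ((n : ℝ) + 1) - f n := by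
    intro n h1 h2
    have h1' : ((m : ℤ) : ℝ) ≤ n := by exact_mod_cast h1
    have h2' : ((n : ℤ) : ℝ) + 1 ≤ M := by exact_mod_cast h2
    exact exists_deriv_eq_step H.hasDeriv (by linarith) (by linarith)
  apply kusminLandau (φ := fun n : ℤ => f n) (ν := ν) hδ hδ2
  · intro n h1 h2
    have h2' : n + 1 ≤ M := by omega
    obtain ⟨ξ, hξ1, hξ2, hξ⟩ := hstep n h1 h2'
    have h1r : ((m : ℤ) : ℝ) ≤ n := by exact_mod_cast h1
    have h2r : ((n : ℤ) : ℝ) + 1 ≤ M := by exact_mod_cast h2'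
    have hξI : ξ ∈ Set.Icc a b := ⟨by linarith [hmI.1], by linarith [hMI.2]⟩
    have hlo := H.mono hlam hmI hξI (by linarith)
    have hhi := H.mono hlam hξI hMI (by linarith)
    have e1 : f ((n + 1 : ℤ) : ℝ) - f n = f' ξ := by rw [hξ]; push_cast; ring_nf
    rw [e1]
    constructor <;> linarith
  · intro n h1 h2
    obtain ⟨ξ₁, hξ11, hξ12, hξ1⟩ := hstep n h1 (by omega)
    obtain ⟨ξ₂, hξ21, hξ22, hξ2⟩ := hstep (n + 1) (by omega) (by omega)
    push_cast at hξ21 hξ22 hξ2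
    have h1r : ((m : ℤ) : ℝ) ≤ n := by exact_mod_cast h1
    have h2r : ((n : ℤ) : ℝ) + 2 ≤ M := by exact_mod_cast (show n + 2 ≤ M by omega)
    have hξ1I : ξ₁ ∈ Set.Icc a b := ⟨by linarith [hmI.1], by linarith [hMI.2]⟩
    have hξ2I : ξ₂ ∈ Set.Icc a b := ⟨by linarith [hmI.1], by linarith [hMI.2]⟩
    have h12 := H.mono hlam hξ1I hξ2I (by linarith)
    have e1 : f ((n + 1 : ℤ) : ℝ) - f n = f' ξ₁ := by rw [hξ1]; push_cast; ring_nf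
    have e2 : f ((n + 2 : ℤ) : ℝ) - f ((n + 1 : ℤ) : ℝ) = f' ξ₂ := by
      rw [hξ2]; push_cast; ring_nf
    rw [e1, e2]
    exact h12

/-- Bound for one fibre `{n ∈ (a, b] : ⌊f'(n)⌋ = ν}`: at most `δ/λ + 1` points with
`f' < ν + δ`, at most `δ/λ + 1` with `f' > ν + 1 - δ`, and Kusmin–Landau in between. [folklore] -/
theorem fibre_bound {a b : ℤ} (H : SecondDerivHyp f f' a b lam h) (hlam : 0 < lam) (ν : ℤ)
    {δ : ℝ} (hδ : 0 < δ) (hδ2 : δ ≤ 1 / 2) :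
    ‖∑ n ∈ (Finset.Ioc a b).filter (fun n : ℤ => ⌊f' n⌋ = ν), e (f n)‖
      ≤ 2 * (δ / lam + 1) + 2 / δ := by
  have hmemI : ∀ n : ℤ, n ∈ Finset.Ioc a b → ((n : ℤ) : ℝ) ∈ Set.Icc (a : ℝ) b := by
    intro n hn
    rw [Finset.mem_Ioc] at hn
    exact ⟨by exact_mod_cast hn.1.le, by exact_mod_cast hn.2⟩
  set F : Finset ℤ := (Finset.Ioc a b).filter (fun n : ℤ => ⌊f' n⌋ = ν) with hFdef
  have hmemF : ∀ n : ℤ, n ∈ F ↔ n ∈ Finset.Ioc a b ∧ ⌊f' n⌋ = ν := by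
    intro n; rw [hFdef, Finset.mem_filter]
  set P : ℤ → Prop := fun n => f' n < ν + δ with hPdef
  set Q : ℤ → Prop := fun n => f' n ≤ ν + 1 - δ with hQdef
  have hsplit : ∑ n ∈ F, e (f n)
      = ∑ n ∈ F.filter P, e (f n) + (∑ n ∈ (F.filter (fun n : ℤ => ¬ P n)).filter Q, e (f n)
        + ∑ n ∈ (F.filter (fun n : ℤ => ¬ P n)).filter (fun n : ℤ => ¬ Q n), e (f n)) := by
    rw [Finset.sum_filter_add_sum_filter_not, Finset.sum_filter_add_sum_filter_not]
  -- A: `ν ≤ f' n < ν + δ`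
  have hA : ((F.filter P).card : ℝ) ≤ δ / lam + 1 := by
    apply card_le_of_diam (by positivity)
    intro n₁ hn₁ n₂ hn₂ h12
    rw [Finset.mem_filter, hmemF] at hn₁ hn₂
    have h1 : (ν : ℝ) ≤ f' n₁ := by
      have := Int.floor_le (f' n₁); rw [hn₁.1.2] at this; exact this
    have h2 : f' n₂ < ν + δ := hn₂.2
    have h3 := (H.incr _ (hmemI _ hn₁.1.1) _ (hmemI _ hn₂.1.1) (by exact_mod_cast h12)).1
    rw [le_div_iff₀ hlam]
    linarith
  -- B: `ν + 1 - δ < f' n < ν + 1`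
  have hB : (((F.filter (fun n : ℤ => ¬ P n)).filter (fun n : ℤ => ¬ Q n)).card : ℝ) ≤ δ / lam + 1 := by
    apply card_le_of_diam (by positivity)
    intro n₁ hn₁ n₂ hn₂ h12
    simp only [Finset.mem_filter, hmemF] at hn₁ hn₂
    have h1 : (ν : ℝ) + 1 - δ < f' n₁ := not_le.1 hn₁.2
    have h2 : f' n₂ < ν + 1 := by
      have := Int.lt_floor_add_one (f' n₂)
      rw [hn₂.1.1.2] at this; exact this
    have h3 := (H.incr _ (hmemI _ hn₁.1.1.1) _ (hmemI _ hn₂.1.1.1) (by exact_mod_cast h12)).1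
    rw [le_div_iff₀ hlam]
    linarith
  -- G: `ν + δ ≤ f' n ≤ ν + 1 - δ`
  have hG : ‖∑ n ∈ (F.filter (fun n : ℤ => ¬ P n)).filter Q, e (f n)‖ ≤ 2 / δ := by
    set G : Finset ℤ := (F.filter (fun n : ℤ => ¬ P n)).filter Q with hGdef
    have hmemG : ∀ n : ℤ, n ∈ G ↔ n ∈ Finset.Ioc a b ∧ (ν : ℝ) + δ ≤ f' n ∧ f' n ≤ ν + 1 - δ := by
      intro n
      simp only [hGdef, Finset.mem_filter, hmemF, hPdef, hQdef, not_lt]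
      constructor
      · rintro ⟨⟨⟨h1, _⟩, h2⟩, h3⟩; exact ⟨h1, h2, h3⟩
      · rintro ⟨h1, h2, h3⟩
        refine ⟨⟨⟨h1, ?_⟩, h2⟩, h3⟩
        rw [Int.floor_eq_iff]
        constructor <;> linarith
    rcases G.eq_empty_or_nonempty with hGe | hGne
    · rw [hGe, sum_empty, norm_zero]; positivity
    have hbetween : ∀ n₁ ∈ G, ∀ n₂ ∈ G, ∀ n, n₁ ≤ n → n ≤ n₂ → n ∈ G := by
      intro n₁ hn₁ n₂ hn₂ n h1 h2
      rw [hmemG] at hn₁ hn₂ ⊢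
      have hnI : n ∈ Finset.Ioc a b := by
        rw [Finset.mem_Ioc] at hn₁ hn₂ ⊢
        exact ⟨lt_of_lt_of_le hn₁.1.1 h1, h2.trans hn₂.1.2⟩
      refine ⟨hnI, ?_, ?_⟩
      · have := H.mono hlam (hmemI _ hn₁.1) (hmemI _ hnI) (by exact_mod_cast h1)
        linarith [hn₁.2.1]
      · have := H.mono hlam (hmemI _ hnI) (hmemI _ hn₂.1) (by exact_mod_cast h2)
        linarith [hn₂.2.2]
    have hGI : G = Finset.Icc (G.min' hGne) (G.max' hGne) := eq_Icc_of_between hGne hbetween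
    have hmG := G.min'_mem hGne
    have hMG := G.max'_mem hGne
    rw [hmemG] at hmG hMG
    rw [hGI]
    exact H.kl_interval hlam hδ hδ2 (hmemI _ hmG.1).1 (hmemI _ hMG.1).2 hmG.2.1 hMG.2.2
  rw [hsplit]
  calc ‖∑ n ∈ F.filter P, e (f n) + (∑ n ∈ (F.filter (fun n : ℤ => ¬ P n)).filter Q, e (f n)
        + ∑ n ∈ (F.filter (fun n : ℤ => ¬ P n)).filter (fun n : ℤ => ¬ Q n), e (f n))‖
      ≤ ‖∑ n ∈ F.filter P, e (f n)‖ + (‖∑ n ∈ (F.filter (fun n : ℤ => ¬ P n)).filter Q, e (f n)‖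
        + ‖∑ n ∈ (F.filter (fun n : ℤ => ¬ P n)).filter (fun n : ℤ => ¬ Q n), e (f n)‖) := by
        refine (norm_add_le _ _).trans ?_
        gcongr
        exact norm_add_le _ _
    _ ≤ (δ / lam + 1) + (2 / δ + (δ / lam + 1)) := by
        gcongr
        · exact (norm_sum_e_le_card _ (fun n => f n)).trans hA
        · exact (norm_sum_e_le_card _ (fun n => f n)).trans hB
    _ = 2 * (δ / lam + 1) + 2 / δ := by ring

/-- The number of fibres: `#{⌊f'(n)⌋ : a < n ≤ b} ≤ h λ (b - a) + 2`. [folklore] -/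
theorem card_fibres_le {a b : ℤ} (H : SecondDerivHyp f f' a b lam h) (hlam : 0 < lam)
    (hh : 1 ≤ h) (hab : a ≤ b) :
    (((Finset.Ioc a b).image (fun n : ℤ => ⌊f' n⌋)).card : ℝ) ≤ h * lam * (b - a) + 2 := by
  have hmemI : ∀ n : ℤ, n ∈ Finset.Ioc a b → ((n : ℤ) : ℝ) ∈ Set.Icc (a : ℝ) b := by
    intro n hn
    rw [Finset.mem_Ioc] at hn
    exact ⟨by exact_mod_cast hn.1.le, by exact_mod_cast hn.2⟩
  have hab' : ((a : ℤ) : ℝ) ≤ b := by exact_mod_cast hab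
  set g : ℤ → ℤ := fun n => ⌊f' n⌋ with hgdef
  rcases (Finset.Ioc a b).eq_empty_or_nonempty with hemp | hne
  · rw [hemp, Finset.image_empty, Finset.card_empty]; push_cast
    nlinarith [mul_nonneg (mul_nonneg (zero_le_one.trans hh) hlam.le) (sub_nonneg.2 hab')]
  have hab1 : a < b := by
    obtain ⟨n, hn⟩ := hne; rw [Finset.mem_Ioc] at hn; omega
  have ha1 : a + 1 ∈ Finset.Ioc a b := by rw [Finset.mem_Ioc]; omega
  have hb : b ∈ Finset.Ioc a b := by rw [Finset.mem_Ioc]; omega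
  have hsub : (Finset.Ioc a b).image g ⊆ Finset.Icc (g (a + 1)) (g b) := by
    intro ν hν
    rw [Finset.mem_image] at hν
    obtain ⟨n, hn, rfl⟩ := hν
    have hnI := hmemI n hn
    rw [Finset.mem_Ioc] at hn
    rw [Finset.mem_Icc]
    constructor
    · exact Int.floor_mono (H.mono hlam (hmemI _ ha1) hnI (by exact_mod_cast hn.1))
    · exact Int.floor_mono (H.mono hlam hnI (hmemI _ hb) (by exact_mod_cast hn.2))
  have hab1' : ((a + 1 : ℤ) : ℝ) ≤ b := by exact_mod_cast hab1
  have hgab : g (a + 1) ≤ g b :=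
    Int.floor_mono (H.mono hlam (hmemI _ ha1) (hmemI _ hb) hab1')
  have hdiff : ((g b : ℤ) : ℝ) - g (a + 1) ≤ h * lam * (b - a) + 1 := by
    have h1 : ((g b : ℤ) : ℝ) ≤ f' b := Int.floor_le _
    have h2 : f' ((a + 1 : ℤ) : ℝ) < g (a + 1) + 1 := Int.lt_floor_add_one _
    have h3 : ((a + 1 : ℤ) : ℝ) ≤ b := by push_cast; exact_mod_cast hab1
    have h4 := (H.incr _ (hmemI _ ha1) _ (hmemI _ hb) h3).2
    have h6 : h * lam * ((b : ℝ) - ((a + 1 : ℤ) : ℝ)) ≤ h * lam * (b - a) := by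
      apply mul_le_mul_of_nonneg_left _ (by positivity)
      push_cast; linarith
    linarith
  calc (((Finset.Ioc a b).image g).card : ℝ) ≤ ((Finset.Icc (g (a + 1)) (g b)).card : ℝ) := by
        exact_mod_cast Finset.card_le_card hsub
    _ ≤ (((g b : ℤ) : ℝ) - g (a + 1)) + 1 := by
        apply card_le_of_diam (by
          have : ((g (a + 1) : ℤ) : ℝ) ≤ g b := by exact_mod_cast hgab
          linarith)
        intro n₁ hn₁ n₂ hn₂ _
        rw [Finset.mem_Icc] at hn₁ hn₂
        have e1 : ((n₂ : ℤ) : ℝ) ≤ g b := by exact_mod_cast hn₂.2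
        have e2 : ((g (a + 1) : ℤ) : ℝ) ≤ n₁ := by exact_mod_cast hn₁.1
        linarith
    _ ≤ h * lam * (b - a) + 2 := by linarith

end SecondDerivHyp

/-- **Second derivative test, core form** (van der Corput; Graham–Kolesnik Thm 2.2). If `f` is
differentiable on `[a, b]` (`a ≤ b` integers) and the increments of `f'` satisfy
`λ (y₂ - y₁) ≤ f'(y₂) - f'(y₁) ≤ h λ (y₂ - y₁)` (`0 < λ`, `1 ≤ h`), then
`‖∑_{a < n ≤ b} e(f(n))‖ ≤ 12 (h (b - a) λ^{1/2} + λ^{-1/2})`.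
[cite: GrahamKolesnik1991, Thm 2.2 (van der Corput), proof p. 11] -/
theorem secondDerivTest_core {f f' : ℝ → ℝ} {a b : ℤ} {lam h : ℝ} (hab : a ≤ b)
    (hlam : 0 < lam) (hh : 1 ≤ h) (H : SecondDerivHyp f f' a b lam h) :
    ‖∑ n ∈ Finset.Ioc a b, e (f n)‖
      ≤ 12 * (h * ((b : ℝ) - a) * Real.sqrt lam + 1 / Real.sqrt lam) := by
  have hsq : 0 < Real.sqrt lam := Real.sqrt_pos.2 hlam
  have hab' : (a : ℝ) ≤ b := by exact_mod_cast hab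
  have hL0 : (0 : ℝ) ≤ (b : ℝ) - a := by linarith
  set L : ℝ := (b : ℝ) - a with hLdef
  -- trivial bound
  have htriv : ‖∑ n ∈ Finset.Ioc a b, e (f n)‖ ≤ L := by
    refine (norm_sum_e_le_card _ (fun n => f n)).trans ?_
    rw [Int.card_Ioc, hLdef]
    have h1 : (((b - a).toNat : ℕ) : ℤ) = b - a := Int.toNat_of_nonneg (by linarith)
    have h2 : (((b - a).toNat : ℕ) : ℝ) = ((b - a : ℤ) : ℝ) := by exact_mod_cast h1
    rw [h2]; push_cast; exact le_rfl
  -- Case `λ > 1/4`: the trivial bound suffices.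
  rcases lt_or_ge (1 / 4 : ℝ) lam with hbig | hsmall
  · have hs2 : 1 / 2 < Real.sqrt lam := by
      rw [show (1 / 2 : ℝ) = Real.sqrt (1 / 4) by
        rw [show (1 / 4 : ℝ) = (1 / 2) ^ 2 by norm_num, Real.sqrt_sq (by norm_num)]]
      exact Real.sqrt_lt_sqrt (by norm_num) hbig
    refine htriv.trans ?_
    have h1 : 1 / 2 ≤ h * Real.sqrt lam := by
      have : Real.sqrt lam ≤ h * Real.sqrt lam := by
        calc Real.sqrt lam = 1 * Real.sqrt lam := (one_mul _).symm
          _ ≤ h * Real.sqrt lam := mul_le_mul_of_nonneg_right hh hsq.le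
      linarith
    have h2 : L * (1 / 2) ≤ L * (h * Real.sqrt lam) := mul_le_mul_of_nonneg_left h1 hL0
    have h3 : 0 < 1 / Real.sqrt lam := by positivity
    nlinarith [h2, h3]
  -- Main case `λ ≤ 1/4`, `δ = √λ ≤ 1/2`.
  set δ : ℝ := Real.sqrt lam with hδdef
  have hδ : 0 < δ := hsq
  have hδsq : δ ^ 2 = lam := Real.sq_sqrt hlam.le
  have hδ2 : δ ≤ 1 / 2 := by
    rw [hδdef, show (1 / 2 : ℝ) = Real.sqrt (1 / 4) by
      rw [show (1 / 4 : ℝ) = (1 / 2) ^ 2 by norm_num, Real.sqrt_sq (by norm_num)]]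
    exact Real.sqrt_le_sqrt hsmall
  have hδlam : δ / lam = 1 / δ := by
    rw [← hδsq]; field_simp
  have hlamδ : lam / δ = δ := by
    rw [← hδsq]; field_simp
  have h2δ : (2 : ℝ) ≤ 1 / δ := by rw [le_div_iff₀ hδ]; linarith
  set g : ℤ → ℤ := fun n => ⌊f' n⌋ with hgdef
  set V : Finset ℤ := (Finset.Ioc a b).image g with hVdef
  have hfib : ∑ n ∈ Finset.Ioc a b, e (f n)
      = ∑ ν ∈ V, ∑ n ∈ (Finset.Ioc a b).filter (fun n : ℤ => g n = ν), e (f n) :=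
    (Finset.sum_fiberwise_of_maps_to (fun n hn => Finset.mem_image_of_mem g hn) _).symm
  have hcardV : (V.card : ℝ) ≤ h * lam * L + 2 := H.card_fibres_le hlam hh hab
  rw [hfib]
  calc ‖∑ ν ∈ V, ∑ n ∈ (Finset.Ioc a b).filter (fun n : ℤ => g n = ν), e (f n)‖
      ≤ ∑ ν ∈ V, ‖∑ n ∈ (Finset.Ioc a b).filter (fun n : ℤ => g n = ν), e (f n)‖ := norm_sum_le _ _
    _ ≤ ∑ ν ∈ V, (2 * (δ / lam + 1) + 2 / δ) :=
        Finset.sum_le_sum fun ν _ => H.fibre_bound hlam ν hδ hδ2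
    _ = V.card * (2 * (δ / lam + 1) + 2 / δ) := by rw [Finset.sum_const, nsmul_eq_mul]
    _ ≤ (h * lam * L + 2) * (2 * (δ / lam + 1) + 2 / δ) := by
        apply mul_le_mul_of_nonneg_right hcardV; positivity
    _ = (h * lam * L + 2) * (4 * (1 / δ) + 2) := by rw [hδlam]; ring
    _ ≤ (h * lam * L + 2) * (5 * (1 / δ)) := by
        apply mul_le_mul_of_nonneg_left _ (by positivity)
        linarith
    _ = 5 * (h * L * (lam / δ)) + 10 * (1 / δ) := by ring
    _ = 5 * (h * L * δ) + 10 * (1 / δ) := by rw [hlamδ]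
    _ ≤ 12 * (h * L * δ + 1 / δ) := by
        have : 0 ≤ h * L * δ := by positivity
        have : 0 ≤ 1 / δ := by positivity
        nlinarith

/-- **Second derivative test** with the classical hypothesis `λ ≤ f'' ≤ h λ` on `[a, b]`.
[cite: GrahamKolesnik1991, Thm 2.2 (van der Corput)] -/
theorem secondDerivTest {f f' f'' : ℝ → ℝ} {a b : ℤ} {lam h : ℝ} (hab : a ≤ b)
    (hlam : 0 < lam) (hh : 1 ≤ h)
    (hf : ∀ y ∈ Set.Icc (a : ℝ) b, HasDerivAt f (f' y) y)
    (hf' : ∀ y ∈ Set.Icc (a : ℝ) b, HasDerivAt f' (f'' y) y)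
    (hbound : ∀ y ∈ Set.Icc (a : ℝ) b, lam ≤ f'' y ∧ f'' y ≤ h * lam) :
    ‖∑ n ∈ Finset.Ioc a b, e (f n)‖
      ≤ 12 * (h * ((b : ℝ) - a) * Real.sqrt lam + 1 / Real.sqrt lam) := by
  refine secondDerivTest_core hab hlam hh ⟨hf, ?_⟩
  intro y₁ h1 y₂ h2 h12
  rcases eq_or_lt_of_le h12 with heq | hlt
  · subst heq; simp
  have hsub : Set.Icc y₁ y₂ ⊆ Set.Icc (a : ℝ) b := Set.Icc_subset_Icc h1.1 h2.2
  -- mean value theorem for `f'` on `[y₁, y₂]`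
  obtain ⟨ξ, hξ, hξ'⟩ := exists_hasDerivAt_eq_slope f' f'' hlt
    (fun y hy => (hf' y (hsub hy)).continuousAt.continuousWithinAt)
    (fun y hy => hf' y (hsub (Set.Ioo_subset_Icc_self hy)))
  have hξI : ξ ∈ Set.Icc (a : ℝ) b := hsub (Set.Ioo_subset_Icc_self hξ)
  have hpos : 0 < y₂ - y₁ := by linarith
  have heq : f' y₂ - f' y₁ = f'' ξ * (y₂ - y₁) := by
    rw [hξ']; field_simp
  rw [heq]
  obtain ⟨hl, hu⟩ := hbound ξ hξI
  constructor
  · nlinarith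
  · nlinarith

end VdC
end Literature.NumberTheory.LFunctions

/-! ## Part 3: the Weyl–van der Corput inequality (Graham–Kolesnik Lemma 2.5, eq. (2.3.4)) -/

namespace Literature.NumberTheory.LFunctions
namespace VdC

open Finset Real

/-- Correlation sum `C(d) = ∑_{a < n ≤ b} z(n + d) conj z(n)`. [folklore] -/
noncomputable def corr (z : ℤ → ℂ) (a b d : ℤ) : ℂ :=
  ∑ n ∈ Finset.Ioc a b, z (n + d) * (starRingEnd ℂ) (z n)

/-- Sums of a function vanishing outside `T ⊆ A` over `A` and over `T` agree. [folklore] -/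
theorem sum_eq_sum_of_vanish {w : ℤ → ℂ} {A T : Finset ℤ} (hT : T ⊆ A)
    (hw : ∀ n, n ∉ T → w n = 0) : ∑ n ∈ A, w n = ∑ n ∈ T, w n := by
  symm
  exact Finset.sum_subset hT fun n _ hn => hw n hn

/-- Shifting the summation variable: `∑_{c<m≤d} w(m+t) = ∑_{c+t<n≤d+t} w(n)`. [folklore] -/
theorem sum_Ioc_shift (w : ℤ → ℂ) (c d t : ℤ) :
    ∑ m ∈ Finset.Ioc c d, w (m + t) = ∑ n ∈ Finset.Ioc (c + t) (d + t), w n := by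
  rw [← Finset.map_add_right_Ioc, Finset.sum_map]
  rfl

/-- `‖∑ x_j‖² = ∑_{j, j'} Re (x_j conj x_{j'})`. [folklore] -/
theorem norm_sq_sum_eq (J : Finset ℕ) (x : ℕ → ℂ) :
    ‖∑ j ∈ J, x j‖ ^ 2 = ∑ j ∈ J, ∑ j' ∈ J, (x j * (starRingEnd ℂ) (x j')).re := by
  have h1 : ‖∑ j ∈ J, x j‖ ^ 2 = ((∑ j ∈ J, x j) * (starRingEnd ℂ) (∑ j ∈ J, x j)).re := by
    rw [Complex.mul_conj, Complex.ofReal_re, Complex.normSq_eq_norm_sq]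
  rw [h1, map_sum, Finset.sum_mul_sum, Complex.re_sum]
  congr 1
  ext j
  rw [Complex.re_sum]

/-- Cauchy–Schwarz: `‖∑_{m ∈ M} w m‖² ≤ #M ∑ ‖w m‖²`. [folklore] -/
theorem norm_sq_sum_le_card_mul (M : Finset ℤ) (w : ℤ → ℂ) :
    ‖∑ m ∈ M, w m‖ ^ 2 ≤ M.card * ∑ m ∈ M, ‖w m‖ ^ 2 := by
  calc ‖∑ m ∈ M, w m‖ ^ 2 ≤ (∑ m ∈ M, ‖w m‖) ^ 2 := by
        gcongr
        exact norm_sum_le _ _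
    _ ≤ M.card * ∑ m ∈ M, ‖w m‖ ^ 2 := sq_sum_le_card_mul_sum_sq

section support

variable {z : ℤ → ℂ} {a b : ℤ} (hz : ∀ n, n ∉ Finset.Ioc a b → z n = 0)
include hz

/-- `corr` restricted to its support `(a, b - d]` for `d ≥ 0`. [folklore] -/
theorem corr_eq_sum_Ioc_sub {d : ℤ} (hd : 0 ≤ d) :
    corr z a b d = ∑ n ∈ Finset.Ioc a (b - d), z (n + d) * (starRingEnd ℂ) (z n) := by
  unfold corr
  apply sum_eq_sum_of_vanish (Finset.Ioc_subset_Ioc le_rfl (by linarith))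
  intro n hn
  by_cases hn' : n ∈ Finset.Ioc a b
  · have : n + d ∉ Finset.Ioc a b := by
      rw [Finset.mem_Ioc] at hn hn' ⊢; omega
    rw [hz _ this, zero_mul]
  · rw [hz _ hn', map_zero, mul_zero]

/-- Symmetry `corr(-d) = conj corr(d)`. [folklore] -/
theorem corr_neg {d : ℤ} (hd : 0 ≤ d) : corr z a b (-d) = (starRingEnd ℂ) (corr z a b d) := by
  rw [corr_eq_sum_Ioc_sub hz hd, map_sum]
  unfold corr
  have hA : ∑ n ∈ Finset.Ioc a b, z (n + -d) * (starRingEnd ℂ) (z n)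
      = ∑ n ∈ Finset.Ioc (a + d) b, z (n + -d) * (starRingEnd ℂ) (z n) := by
    apply sum_eq_sum_of_vanish (Finset.Ioc_subset_Ioc (by linarith) le_rfl)
    intro n hn
    by_cases hn' : n ∈ Finset.Ioc a b
    · have : n + -d ∉ Finset.Ioc a b := by rw [Finset.mem_Ioc] at hn hn' ⊢; omega
      rw [hz _ this, zero_mul]
    · rw [hz _ hn', map_zero, mul_zero]
  have hB : ∑ m ∈ Finset.Ioc a (b - d), (starRingEnd ℂ) (z (m + d) * (starRingEnd ℂ) (z m))
      = ∑ n ∈ Finset.Ioc (a + d) b, z (n + -d) * (starRingEnd ℂ) (z n) := by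
    have h2 := sum_Ioc_shift (fun n => z (n + -d) * (starRingEnd ℂ) (z n)) a (b - d) d
    rw [sub_add_cancel] at h2
    rw [← h2]
    refine Finset.sum_congr rfl fun m _ => ?_
    have e1 : m + d + -d = m := by ring
    simp only [map_mul, Complex.conj_conj, e1]
    ring
  rw [hA, hB]

/-- **Weyl–van der Corput inequality** (Graham–Kolesnik Lemma 2.5): for `z` supported in
`(a, b]` (`a ≤ b`) and `1 ≤ H`,
`H² ‖∑ z(n)‖² ≤ (b - a + H) H (‖C(0)‖ + 2 ∑_{1 ≤ d < H} ‖C(d)‖)`.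
[cite: GrahamKolesnik1991, Lemma 2.5 (Weyl–van der Corput)] -/
theorem vanDerCorput_ineq (hab : a ≤ b) {H : ℕ} (hH : 1 ≤ H) :
    (H : ℝ) ^ 2 * ‖∑ n ∈ Finset.Ioc a b, z n‖ ^ 2
      ≤ ((b : ℝ) - a + H) * (H * (‖corr z a b 0‖
          + 2 * ∑ d ∈ Finset.Ico (1 : ℤ) H, ‖corr z a b d‖)) := by
  set S := ∑ n ∈ Finset.Ioc a b, z n with hS
  set M : Finset ℤ := Finset.Ioc (a - H) b with hM
  have hcardM : (M.card : ℝ) = (b : ℝ) - a + H := by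
    rw [hM, Int.card_Ioc]
    have h0 : 0 ≤ b - (a - H) := by omega
    have h1 : (((b - (a - H)).toNat : ℕ) : ℤ) = b - (a - H) := Int.toNat_of_nonneg h0
    have h2 : (((b - (a - H)).toNat : ℕ) : ℝ) = ((b - (a - H) : ℤ) : ℝ) := by exact_mod_cast h1
    rw [h2]; push_cast; ring
  -- Step 1: `H S = ∑_{m ∈ M} ∑_{j < H} z(m + j)`
  have hshift : ∀ j ∈ Finset.range H, ∑ m ∈ M, z (m + j) = S := by
    intro j hj
    rw [Finset.mem_range] at hj
    rw [hM, sum_Ioc_shift, hS]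
    exact sum_eq_sum_of_vanish (Finset.Ioc_subset_Ioc (by omega) (by omega)) hz
  have hHS : (H : ℂ) * S = ∑ m ∈ M, ∑ j ∈ Finset.range H, z (m + j) := by
    rw [Finset.sum_comm, Finset.sum_congr rfl hshift, Finset.sum_const, Finset.card_range,
      nsmul_eq_mul]
  -- Step 2: Cauchy–Schwarz
  have hCS := norm_sq_sum_le_card_mul M (fun m => ∑ j ∈ Finset.range H, z (m + j))
  -- Step 3: expand the squares
  have hexp : ∑ m ∈ M, ‖∑ j ∈ Finset.range H, z (m + j)‖ ^ 2
      = ∑ j ∈ Finset.range H, ∑ j' ∈ Finset.range H,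
          (corr z a b ((j : ℤ) - j')).re := by
    have h1 : ∀ m ∈ M, ‖∑ j ∈ Finset.range H, z (m + j)‖ ^ 2
        = ∑ j ∈ Finset.range H, ∑ j' ∈ Finset.range H,
            (z (m + j) * (starRingEnd ℂ) (z (m + j'))).re :=
      fun m _ => norm_sq_sum_eq _ _
    rw [Finset.sum_congr rfl h1, Finset.sum_comm]
    refine Finset.sum_congr rfl fun j hj => ?_
    rw [Finset.sum_comm]
    refine Finset.sum_congr rfl fun j' hj' => ?_
    rw [← Complex.re_sum]
    congr 1
    -- `∑_{m ∈ M} z(m+j) conj z(m+j') = corr (j - j')`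
    rw [Finset.mem_range] at hj hj'
    have h2 := sum_Ioc_shift (fun n => z (n + ((j : ℤ) - j')) * (starRingEnd ℂ) (z n)) (a - H) b j'
    have h3 : ∀ m : ℤ, z (m + j) * (starRingEnd ℂ) (z (m + j'))
        = z (m + j' + ((j : ℤ) - j')) * (starRingEnd ℂ) (z (m + j')) := by
      intro m
      have : m + j' + ((j : ℤ) - j') = m + j := by ring
      rw [this]
    rw [hM, Finset.sum_congr rfl (fun m _ => h3 m), h2]
    unfold corr
    apply sum_eq_sum_of_vanish (Finset.Ioc_subset_Ioc (by omega) (by omega))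
    intro n hn
    simp only [hz n hn, map_zero, mul_zero]
  -- Step 4: bound the double sum of correlations
  have hcorr : ∑ j ∈ Finset.range H, ∑ j' ∈ Finset.range H, (corr z a b ((j : ℤ) - j')).re
      ≤ H * (‖corr z a b 0‖ + 2 * ∑ d ∈ Finset.Ico (1 : ℤ) H, ‖corr z a b d‖) := by
    have hg0 : ∀ d ∈ Finset.Ico (1 : ℤ) H, 0 ≤ ‖corr z a b d‖ := fun d _ => norm_nonneg _
    have hrow : ∀ j ∈ Finset.range H, ∑ j' ∈ Finset.range H, (corr z a b ((j : ℤ) - j')).re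
        ≤ ‖corr z a b 0‖ + 2 * ∑ d ∈ Finset.Ico (1 : ℤ) H, ‖corr z a b d‖ := by
      intro j hj
      rw [Finset.mem_range] at hj
      have hle : ∀ j' ∈ Finset.range H, (corr z a b ((j : ℤ) - j')).re ≤ ‖corr z a b ((j : ℤ) - j')‖ :=
        fun j' _ => Complex.re_le_norm _
      refine (Finset.sum_le_sum hle).trans ?_
      rw [Finset.range_eq_Ico, ← Finset.sum_Ico_consecutive _ (Nat.zero_le j) hj.le,
        Finset.sum_eq_sum_Ico_succ_bot hj, sub_self]
      -- lower part: d = j - j' ∈ [1, j]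
      have hlow : ∑ j' ∈ Finset.Ico 0 j, ‖corr z a b ((j : ℤ) - j')‖
          ≤ ∑ d ∈ Finset.Ico (1 : ℤ) H, ‖corr z a b d‖ := by
        rw [← Finset.sum_image (f := fun d : ℤ => ‖corr z a b d‖)
          (s := Finset.Ico 0 j) (g := fun j' : ℕ => (j : ℤ) - j')]
        · apply Finset.sum_le_sum_of_subset_of_nonneg
          · intro d hd
            rw [Finset.mem_image] at hd
            obtain ⟨j', hj', rfl⟩ := hd
            rw [Finset.mem_Ico] at hj' ⊢
            omega
          · intro d _ _; exact norm_nonneg _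
        · intro x _ y _ hxy
          have : (x : ℤ) = y := by linarith
          exact_mod_cast this
      -- upper part: d = j' - j ∈ [1, H - 1 - j], using `‖corr(-d)‖ = ‖corr d‖`
      have hup : ∑ j' ∈ Finset.Ico (j + 1) H, ‖corr z a b ((j : ℤ) - j')‖
          ≤ ∑ d ∈ Finset.Ico (1 : ℤ) H, ‖corr z a b d‖ := by
        have hsymm : ∀ j' ∈ Finset.Ico (j + 1) H,
            ‖corr z a b ((j : ℤ) - j')‖ = ‖corr z a b ((j' : ℤ) - j)‖ := by
          intro j' hj'
          rw [Finset.mem_Ico] at hj'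
          have : (j : ℤ) - j' = -((j' : ℤ) - j) := by ring
          rw [this, corr_neg hz (by omega), Complex.norm_conj]
        rw [Finset.sum_congr rfl hsymm,
          ← Finset.sum_image (f := fun d : ℤ => ‖corr z a b d‖)
            (s := Finset.Ico (j + 1) H) (g := fun j' : ℕ => (j' : ℤ) - j)]
        · apply Finset.sum_le_sum_of_subset_of_nonneg
          · intro d hd
            rw [Finset.mem_image] at hd
            obtain ⟨j', hj', rfl⟩ := hd
            rw [Finset.mem_Ico] at hj' ⊢
            omega
          · intro d _ _; exact norm_nonneg _
        · intro x _ y _ hxy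
          have : (x : ℤ) = y := by linarith
          exact_mod_cast this
      have hsum0 : 0 ≤ ∑ d ∈ Finset.Ico (1 : ℤ) H, ‖corr z a b d‖ := Finset.sum_nonneg hg0
      linarith
    calc ∑ j ∈ Finset.range H, ∑ j' ∈ Finset.range H, (corr z a b ((j : ℤ) - j')).re
        ≤ ∑ j ∈ Finset.range H, (‖corr z a b 0‖ + 2 * ∑ d ∈ Finset.Ico (1 : ℤ) H, ‖corr z a b d‖) :=
          Finset.sum_le_sum hrow
      _ = H * (‖corr z a b 0‖ + 2 * ∑ d ∈ Finset.Ico (1 : ℤ) H, ‖corr z a b d‖) := by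
          rw [Finset.sum_const, Finset.card_range, nsmul_eq_mul]
  -- assemble
  have hnormHS : (H : ℝ) ^ 2 * ‖S‖ ^ 2 = ‖(H : ℂ) * S‖ ^ 2 := by
    rw [norm_mul, Complex.norm_natCast]; ring
  rw [hnormHS, hHS]
  calc ‖∑ m ∈ M, ∑ j ∈ Finset.range H, z (m + j)‖ ^ 2
      ≤ M.card * ∑ m ∈ M, ‖∑ j ∈ Finset.range H, z (m + j)‖ ^ 2 := hCS
    _ = ((b : ℝ) - a + H) * ∑ j ∈ Finset.range H, ∑ j' ∈ Finset.range H,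
          (corr z a b ((j : ℤ) - j')).re := by rw [hcardM, hexp]
    _ ≤ ((b : ℝ) - a + H) * (H * (‖corr z a b 0‖
          + 2 * ∑ d ∈ Finset.Ico (1 : ℤ) H, ‖corr z a b d‖)) := by
        apply mul_le_mul_of_nonneg_left hcorr
        have : (a : ℝ) ≤ b := by exact_mod_cast hab
        have : (0 : ℝ) ≤ H := by positivity
        linarith

/-- The form (2.3.4) of Graham–Kolesnik: if moreover `‖z‖ ≤ 1` and `H ≤ b - a` then
`‖∑ z(n)‖² ≤ 2 (b-a)²/H + (4 (b-a)/H) ∑_{1 ≤ d < H} ‖C(d)‖`.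
[cite: GrahamKolesnik1991, eq. (2.3.4)] -/
theorem vanDerCorput_ineq' (hz1 : ∀ n, ‖z n‖ ≤ 1) {H : ℕ} (hH : 1 ≤ H) (hHL : (H : ℤ) ≤ b - a) :
    ‖∑ n ∈ Finset.Ioc a b, z n‖ ^ 2
      ≤ 2 * ((b : ℝ) - a) ^ 2 / H
        + 4 * ((b : ℝ) - a) / H * ∑ d ∈ Finset.Ico (1 : ℤ) H, ‖corr z a b d‖ := by
  have hab : a ≤ b := by omega
  have hHpos : (0 : ℝ) < H := by exact_mod_cast hH
  have hHL' : (H : ℝ) ≤ (b : ℝ) - a := by exact_mod_cast hHL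
  set L : ℝ := (b : ℝ) - a with hL
  have hmain := vanDerCorput_ineq hz hab hH
  -- `‖corr 0‖ ≤ L`
  have hC0 : ‖corr z a b 0‖ ≤ L := by
    unfold corr
    refine (norm_sum_le _ _).trans ?_
    have : ∀ n ∈ Finset.Ioc a b, ‖z (n + 0) * (starRingEnd ℂ) (z n)‖ ≤ 1 := by
      intro n _
      rw [add_zero, norm_mul, Complex.norm_conj]
      have := hz1 n
      have h0 := norm_nonneg (z n)
      nlinarith
    refine (Finset.sum_le_sum this).trans ?_
    rw [Finset.sum_const, nsmul_eq_mul, mul_one, Int.card_Ioc]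
    have h1 : (((b - a).toNat : ℕ) : ℤ) = b - a := Int.toNat_of_nonneg (by omega)
    have h2 : (((b - a).toNat : ℕ) : ℝ) = ((b - a : ℤ) : ℝ) := by exact_mod_cast h1
    rw [h2]; push_cast; rw [hL]
  set T := ∑ d ∈ Finset.Ico (1 : ℤ) H, ‖corr z a b d‖ with hT
  have hT0 : 0 ≤ T := Finset.sum_nonneg fun d _ => norm_nonneg _
  have hL0 : 0 ≤ L := by linarith [hHpos]
  -- divide by H²
  have h1 : ‖∑ n ∈ Finset.Ioc a b, z n‖ ^ 2 ≤ (L + H) / H * (‖corr z a b 0‖ + 2 * T) := by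
    rw [div_mul_eq_mul_div, le_div_iff₀ hHpos]
    have := hmain
    nlinarith [hmain, hHpos]
  calc ‖∑ n ∈ Finset.Ioc a b, z n‖ ^ 2 ≤ (L + H) / H * (‖corr z a b 0‖ + 2 * T) := h1
    _ ≤ (2 * L) / H * (L + 2 * T) := by
        apply mul_le_mul _ _ (by positivity) (by positivity)
        · apply div_le_div_of_nonneg_right _ hHpos.le; linarith
        · linarith
    _ = 2 * L ^ 2 / H + 4 * L / H * T := by ring

end support

/-- The Weyl–van der Corput inequality for exponential sums `∑_{a<n≤b} e(f(n))`:
`‖S‖² ≤ 2 (b-a)²/H + (4 (b-a)/H) ∑_{1 ≤ d < H} ‖∑_{a < n ≤ b-d} e(f(n+d) - f(n))‖`.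
[cite: GrahamKolesnik1991, eq. (2.3.4)] -/
theorem vanDerCorput_e (f : ℝ → ℝ) {a b : ℤ} {H : ℕ} (hH : 1 ≤ H) (hHL : (H : ℤ) ≤ b - a) :
    ‖∑ n ∈ Finset.Ioc a b, e (f n)‖ ^ 2
      ≤ 2 * ((b : ℝ) - a) ^ 2 / H
        + 4 * ((b : ℝ) - a) / H *
          ∑ d ∈ Finset.Ico (1 : ℤ) H, ‖∑ n ∈ Finset.Ioc a (b - d), e (f ((n + d : ℤ)) - f n)‖ := by
  classical
  set z : ℤ → ℂ := fun n => if n ∈ Finset.Ioc a b then e (f n) else 0 with hzdef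
  have hz : ∀ n, n ∉ Finset.Ioc a b → z n = 0 := fun n hn => by
    simp only [hzdef]; rw [if_neg hn]
  have hz1 : ∀ n, ‖z n‖ ≤ 1 := by
    intro n; by_cases hn : n ∈ Finset.Ioc a b
    · simp only [hzdef]; rw [if_pos hn, norm_e]
    · rw [hz n hn, norm_zero]; exact zero_le_one
  have hS : ∑ n ∈ Finset.Ioc a b, e (f n) = ∑ n ∈ Finset.Ioc a b, z n :=
    Finset.sum_congr rfl fun n hn => by simp only [hzdef]; rw [if_pos hn]
  have hcorr : ∀ d ∈ Finset.Ico (1 : ℤ) H,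
      ‖corr z a b d‖ = ‖∑ n ∈ Finset.Ioc a (b - d), e (f ((n + d : ℤ)) - f n)‖ := by
    intro d hd
    rw [Finset.mem_Ico] at hd
    rw [corr_eq_sum_Ioc_sub hz (by omega)]
    congr 1
    refine Finset.sum_congr rfl fun n hn => ?_
    rw [Finset.mem_Ioc] at hn
    have h1 : n ∈ Finset.Ioc a b := by rw [Finset.mem_Ioc]; omega
    have h2 : n + d ∈ Finset.Ioc a b := by rw [Finset.mem_Ioc]; omega
    simp only [hzdef]
    rw [if_pos h1, if_pos h2, e_sub]
  rw [hS, ← Finset.sum_congr rfl hcorr]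
  exact vanDerCorput_ineq' hz hz1 hH hHL

end VdC
end Literature.NumberTheory.LFunctions

/-! ## Part 4: the `k`-th derivative test (shape of Titchmarsh Thm 5.13 / Graham–Kolesnik Thm 2.8) -/

namespace Literature.NumberTheory.LFunctions
namespace VdC

open Finset Real

/-- A family of successive derivatives on `[a, b]`: `D (j+1)` is the derivative of `D j` for
`j < k`. [folklore] -/
def DerivFamily (D : ℕ → ℝ → ℝ) (a b : ℝ) (k : ℕ) : Prop :=
  ∀ j, j < k → ∀ y ∈ Set.Icc a b, HasDerivAt (D j) (D (j + 1) y) y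

/-- The conclusion shape of the `k`-th derivative test with constants `C, α, β`:
for every phase family with `λ ≤ D k ≤ h λ` on `[a, b]`,
`‖∑_{a<n≤b} e(D 0 n)‖ ≤ C ((b-a) λ^α + (b-a)^{1-β} λ^{-β/2})`. [folklore] -/
def KBoundWith (h : ℝ) (k : ℕ) (C α β : ℝ) : Prop :=
  ∀ lam : ℝ, 0 < lam → ∀ a b : ℤ, a < b → ∀ D : ℕ → ℝ → ℝ, DerivFamily D a b k →
    (∀ y ∈ Set.Icc (a : ℝ) b, lam ≤ D k y ∧ D k y ≤ h * lam) →
      ‖∑ n ∈ Finset.Ioc a b, e (D 0 n)‖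
        ≤ C * (((b : ℝ) - a) * lam ^ α + ((b : ℝ) - a) ^ (1 - β) * lam ^ (-(β / 2)))

/-- Base case `k = 2` from the second derivative test: `C = 12 h`, `α = 1/2`, `β = 1`. [folklore] -/
theorem kbound_two {h : ℝ} (hh : 1 ≤ h) : KBoundWith h 2 (12 * h) (1 / 2) 1 := by
  intro lam hlam a b hab D hD hbound
  have h0 := hD 0 (by norm_num)
  have h1 := hD 1 (by norm_num)
  have hmain := secondDerivTest hab.le hlam hh h0 h1 hbound
  refine hmain.trans ?_
  have hL : (0 : ℝ) < (b : ℝ) - a := by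
    have : (a : ℝ) < b := by exact_mod_cast hab
    linarith
  rw [Real.sqrt_eq_rpow, sub_self, Real.rpow_zero, one_mul, Real.rpow_neg hlam.le]
  set r : ℝ := lam ^ (1 / 2 : ℝ) with hr
  have hr0 : 0 < r := Real.rpow_pos_of_pos hlam _
  have h2 : 1 / r ≤ h * r⁻¹ := by
    rw [one_div]; exact le_mul_of_one_le_left (inv_nonneg.2 hr0.le) hh
  calc 12 * (h * ((b : ℝ) - a) * r + 1 / r) = 12 * h * (((b : ℝ) - a) * r) + 12 * (1 / r) := by ring
    _ ≤ 12 * h * (((b : ℝ) - a) * r) + 12 * (h * r⁻¹) := by linarith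
    _ = 12 * h * (((b : ℝ) - a) * r + r⁻¹) := by ring

/-- Differencing a derivative family. [folklore] -/
theorem DerivFamily.diff {D : ℕ → ℝ → ℝ} {a b : ℝ} {k : ℕ} (hD : DerivFamily D a b k)
    {d : ℝ} (hd : 0 ≤ d) :
    DerivFamily (fun j y => D j (y + d) - D j y) a (b - d) k := by
  intro j hj y hy
  have hy1 : y ∈ Set.Icc a b := ⟨hy.1, by linarith [hy.2]⟩
  have hy2 : y + d ∈ Set.Icc a b := ⟨by linarith [hy.1], by linarith [hy.2]⟩
  exact (HasDerivAt.comp_add_const y d (hD j hj (y + d) hy2)).sub (hD j hj y hy1)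

/-- Bounds for the top derivative of the differenced family (mean value theorem). [folklore] -/
theorem DerivFamily.diff_bound {D : ℕ → ℝ → ℝ} {a b : ℝ} {k : ℕ} (hD : DerivFamily D a b (k + 1))
    {lam h d : ℝ} (hd : 0 < d) (hbound : ∀ y ∈ Set.Icc a b, lam ≤ D (k + 1) y ∧ D (k + 1) y ≤ h * lam) :
    ∀ y ∈ Set.Icc a (b - d), d * lam ≤ D k (y + d) - D k y ∧ D k (y + d) - D k y ≤ h * (d * lam) := by
  intro y hy
  have hsub : Set.Icc y (y + d) ⊆ Set.Icc a b := Set.Icc_subset_Icc hy.1 (by linarith [hy.2])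
  have hk := hD k (Nat.lt_succ_self k)
  obtain ⟨ξ, hξ, hξ'⟩ := exists_hasDerivAt_eq_slope (D k) (D (k + 1)) (by linarith : y < y + d)
    (fun t ht => (hk t (hsub ht)).continuousAt.continuousWithinAt)
    (fun t ht => hk t (hsub (Set.Ioo_subset_Icc_self ht)))
  have hξI := hbound ξ (hsub (Set.Ioo_subset_Icc_self hξ))
  have heq : D k (y + d) - D k y = d * D (k + 1) ξ := by
    have : y + d - y = d := by ring
    rw [hξ', this]; field_simp
  rw [heq]
  constructor
  · nlinarith [hξI.1]
  · nlinarith [hξI.2]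

/-- A derivative family of order `k` is one of every order `l ≤ k`. [folklore] -/
theorem DerivFamily.mono {D : ℕ → ℝ → ℝ} {a b : ℝ} {k l : ℕ} (hD : DerivFamily D a b k)
    (hl : l ≤ k) : DerivFamily D a b l :=
  fun j hj => hD j (lt_of_lt_of_le hj hl)

set_option maxHeartbeats 400000 in
/-- The real-variable bookkeeping of the induction step. [folklore] -/
theorem step_algebra {C α β lam L H₀ s T : ℝ} {H : ℕ} (hC : 1 ≤ C) (hα : 0 < α)
    (hlam : 0 < lam) (hL : 1 ≤ L)
    (hH₀ : H₀ = lam ^ (-(α / (1 + α)))) (hH : 1 ≤ H) (hHH₀ : (H : ℝ) ≤ H₀) (hH₀H : H₀ < 2 * H)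
    (hvdc : s ^ 2 ≤ 2 * L ^ 2 / H + 4 * L / H * T)
    (hTb : T ≤ H * (C * (L * ((H : ℝ) * lam) ^ α + L ^ (1 - β) * lam ^ (-(β / 2))))) :
    s ≤ 8 * C * (L * lam ^ (α / (2 * (1 + α))) + L ^ (1 - β / 2) * lam ^ (-(β / 2 / 2))) := by
  set θ : ℝ := α / (1 + α) with hθ
  have hα0 : 0 < 1 + α := by linarith
  have hθpos : 0 < θ := div_pos hα hα0
  have hθ1 : 1 - θ = 1 / (1 + α) := by rw [hθ]; field_simp; ring
  have hθα : (1 - θ) * α = θ := by rw [hθ1, hθ]; field_simp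
  have hHpos : (0 : ℝ) < H := by exact_mod_cast hH
  have hL0 : 0 < L := by linarith
  -- `lam^θ H₀ = 1`
  have hlamθ : 0 < lam ^ θ := Real.rpow_pos_of_pos hlam θ
  have hH₀lam : H₀ * lam ^ θ = 1 := by
    rw [hH₀, Real.rpow_neg hlam.le, inv_mul_cancel₀ hlamθ.ne']
  -- (a) `1/H ≤ 2 lam^θ`
  have ha : 1 / (H : ℝ) ≤ 2 * lam ^ θ := by
    rw [div_le_iff₀ hHpos]
    nlinarith [hH₀lam, hH₀H, hlamθ]
  -- (b) `(H lam)^α ≤ lam^θ`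
  have hb : ((H : ℝ) * lam) ^ α ≤ lam ^ θ := by
    have h1 : (H : ℝ) * lam ≤ H₀ * lam := mul_le_mul_of_nonneg_right hHH₀ hlam.le
    have h2 : H₀ * lam = lam ^ (1 - θ) := by
      rw [hH₀, Real.rpow_sub hlam, Real.rpow_one, Real.rpow_neg hlam.le]
      field_simp
    calc ((H : ℝ) * lam) ^ α ≤ (H₀ * lam) ^ α := Real.rpow_le_rpow (by positivity) h1 hα.le
      _ = lam ^ θ := by rw [h2, ← Real.rpow_mul hlam.le, hθα]
  -- combine: s² ≤ 8 C L² lam^θ + 4 C L L^{1-β} lam^{-β/2}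
  set A : ℝ := L ^ (1 - β) * lam ^ (-(β / 2)) with hA
  have hA0 : 0 ≤ A := by positivity
  have hs2 : s ^ 2 ≤ 8 * C * (L ^ 2 * lam ^ θ) + 4 * C * (L * A) := by
    have h1 : 4 * L / H * T ≤ 4 * L * (C * (L * ((H : ℝ) * lam) ^ α + A)) := by
      calc 4 * L / H * T ≤ 4 * L / H * (H * (C * (L * ((H : ℝ) * lam) ^ α + A))) := by
            apply mul_le_mul_of_nonneg_left hTb; positivity
        _ = 4 * L * (C * (L * ((H : ℝ) * lam) ^ α + A)) := by field_simp
    have h2 : 2 * L ^ 2 / H ≤ 4 * (L ^ 2 * lam ^ θ) := by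
      have : 2 * L ^ 2 / H = 2 * L ^ 2 * (1 / H) := by ring
      rw [this]; nlinarith [ha, sq_nonneg L]
    have h3 : 4 * L * (C * (L * ((H : ℝ) * lam) ^ α)) ≤ 4 * C * (L ^ 2 * lam ^ θ) := by
      have h31 : L * ((H : ℝ) * lam) ^ α ≤ L * lam ^ θ := mul_le_mul_of_nonneg_left hb hL0.le
      have h32 := mul_le_mul_of_nonneg_left h31 (by positivity : (0 : ℝ) ≤ 4 * C * L)
      have e1 : 4 * L * (C * (L * ((H : ℝ) * lam) ^ α)) = 4 * C * L * (L * ((H : ℝ) * lam) ^ α) := by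
        ring
      have e2 : 4 * C * (L ^ 2 * lam ^ θ) = 4 * C * L * (L * lam ^ θ) := by ring
      rw [e1, e2]; exact h32
    have h4 : 4 * (L ^ 2 * lam ^ θ) ≤ 4 * C * (L ^ 2 * lam ^ θ) := by
      have : 0 ≤ L ^ 2 * lam ^ θ := by positivity
      nlinarith
    nlinarith [hvdc, h1, h2, h3, h4]
  -- X = L lam^{θ/2}, Y = L^{1-β/2} lam^{-β/4}
  set X : ℝ := L * lam ^ (θ / 2) with hX
  set Y : ℝ := L ^ (1 - β / 2) * lam ^ (-(β / 2 / 2)) with hY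
  have hX0 : 0 ≤ X := by positivity
  have hY0 : 0 ≤ Y := by positivity
  have hX2 : X ^ 2 = L ^ 2 * lam ^ θ := by
    rw [hX, mul_pow, ← Real.rpow_natCast (lam ^ (θ / 2)) 2, ← Real.rpow_mul hlam.le]
    norm_num
  have hY2 : Y ^ 2 = L * A := by
    rw [hY, hA, mul_pow, ← Real.rpow_natCast (L ^ (1 - β / 2)) 2, ← Real.rpow_mul hL0.le,
      ← Real.rpow_natCast (lam ^ (-(β / 2 / 2))) 2, ← Real.rpow_mul hlam.le]
    have e1 : (1 - β / 2) * ((2 : ℕ) : ℝ) = 1 + (1 - β) := by push_cast; ring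
    have e2 : -(β / 2 / 2) * ((2 : ℕ) : ℝ) = -(β / 2) := by push_cast; ring
    rw [e1, e2, Real.rpow_add hL0, Real.rpow_one]
    ring
  have hfin : s ^ 2 ≤ (8 * C * (X + Y)) ^ 2 := by
    rw [← hX2, ← hY2] at hs2
    have e : (8 * C * (X + Y)) ^ 2 = 64 * C ^ 2 * X ^ 2 + 64 * C ^ 2 * Y ^ 2 + 128 * C ^ 2 * (X * Y) := by
      ring
    have hX2n : 0 ≤ X ^ 2 := sq_nonneg X
    have hY2n : 0 ≤ Y ^ 2 := sq_nonneg Y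
    have hc1 : 8 * C ≤ 64 * C ^ 2 := by nlinarith
    have hc2 : 4 * C ≤ 64 * C ^ 2 := by nlinarith
    have i1 : 8 * C * X ^ 2 ≤ 64 * C ^ 2 * X ^ 2 := mul_le_mul_of_nonneg_right hc1 hX2n
    have i2 : 4 * C * Y ^ 2 ≤ 64 * C ^ 2 * Y ^ 2 := mul_le_mul_of_nonneg_right hc2 hY2n
    have i3 : 0 ≤ 128 * C ^ 2 * (X * Y) := by positivity
    rw [e]; linarith
  have hθ2 : θ / 2 = α / (2 * (1 + α)) := by rw [hθ]; field_simp
  rw [← hθ2]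
  exact (abs_le_of_sq_le_sq' hfin (by positivity)).2


/-- Trivial bound in the `KBoundWith` normalisation. [folklore] -/
theorem norm_sum_e_Ioc_le {a b : ℤ} (hab : a ≤ b) (φ : ℤ → ℝ) :
    ‖∑ n ∈ Finset.Ioc a b, e (φ n)‖ ≤ (b : ℝ) - a := by
  refine (norm_sum_e_le_card _ φ).trans ?_
  rw [Int.card_Ioc]
  have h1 : (((b - a).toNat : ℕ) : ℤ) = b - a := Int.toNat_of_nonneg (by linarith)
  have h2 : (((b - a).toNat : ℕ) : ℝ) = ((b - a : ℤ) : ℝ) := by exact_mod_cast h1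
  rw [h2]; push_cast; exact le_rfl

set_option maxHeartbeats 800000 in
/-- **Induction step of the `k`-th derivative test** (Weyl–van der Corput differencing):
a bound at level `k` with constants `(C, α, β)` gives one at level `k + 1` with constants
`(8C, α/(2(1+α)), β/2)`. [folklore] -/
theorem kbound_step {h : ℝ} {k : ℕ} {C α β : ℝ} (hC : 1 ≤ C) (hα : 0 < α)
    (hα1 : α ≤ 1) (hβ : 0 < β) (hβ1 : β ≤ 1) (HK : KBoundWith h k C α β) :
    KBoundWith h (k + 1) (8 * C) (α / (2 * (1 + α))) (β / 2) := by
  intro lam hlam a b hab D hD hbound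
  have hab' : (a : ℝ) < b := by exact_mod_cast hab
  set L : ℝ := (b : ℝ) - a with hL
  have hL1 : 1 ≤ L := by
    have : a + 1 ≤ b := hab
    have : ((a : ℤ) : ℝ) + 1 ≤ b := by exact_mod_cast this
    linarith
  have hL0 : 0 < L := by linarith
  set s := ‖∑ n ∈ Finset.Ioc a b, e (D 0 n)‖ with hs
  have hs0 : 0 ≤ s := norm_nonneg _
  have htriv : s ≤ L := norm_sum_e_Ioc_le hab.le _
  set α' : ℝ := α / (2 * (1 + α)) with hα'
  have hα'0 : 0 < α' := by rw [hα']; positivity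
  -- the target
  have hRHS2 : 0 ≤ L ^ (1 - β / 2) * lam ^ (-(β / 2 / 2)) := by positivity
  have hRHS1 : 0 ≤ L * lam ^ α' := by positivity
  have h8C : (1 : ℝ) ≤ 8 * C := by linarith
  -- Case `lam ≥ 1`
  rcases le_or_gt 1 lam with hlam1 | hlam1
  · have h1 : L ≤ L * lam ^ α' := by
      have : 1 ≤ lam ^ α' := Real.one_le_rpow hlam1 hα'0.le
      nlinarith
    calc s ≤ L := htriv
      _ ≤ 1 * (L * lam ^ α' + L ^ (1 - β / 2) * lam ^ (-(β / 2 / 2))) := by linarith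
      _ ≤ 8 * C * (L * lam ^ α' + L ^ (1 - β / 2) * lam ^ (-(β / 2 / 2))) :=
          mul_le_mul_of_nonneg_right h8C (by positivity)
  -- Case `lam < 1`
  set θ : ℝ := α / (1 + α) with hθ
  have hθpos : 0 < θ := by rw [hθ]; positivity
  have hθhalf : θ ≤ 1 / 2 := by
    rw [hθ, div_le_iff₀ (by linarith)]; linarith
  set H₀ : ℝ := lam ^ (-θ) with hH₀
  have hH₀1 : 1 ≤ H₀ := Real.one_le_rpow_of_pos_of_le_one_of_nonpos hlam hlam1.le (by linarith)
  rcases le_or_gt L H₀ with hLH | hLH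
  · -- Sub-case `L ≤ H₀`: trivial bound
    have h1 : L ≤ lam ^ (-(1 / 2 : ℝ)) :=
      hLH.trans (Real.rpow_le_rpow_of_exponent_ge hlam hlam1.le (by linarith))
    have h2 : L ^ (β / 2) ≤ lam ^ (-(β / 2 / 2)) := by
      calc L ^ (β / 2) ≤ (lam ^ (-(1 / 2 : ℝ))) ^ (β / 2) :=
            Real.rpow_le_rpow hL0.le h1 (by positivity)
        _ = lam ^ (-(β / 2 / 2)) := by
            rw [← Real.rpow_mul hlam.le]; congr 1; ring
    have h3 : L = L ^ (1 - β / 2) * L ^ (β / 2) := by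
      rw [← Real.rpow_add hL0]; norm_num
    have h4 : L ≤ L ^ (1 - β / 2) * lam ^ (-(β / 2 / 2)) := by
      calc L = L ^ (1 - β / 2) * L ^ (β / 2) := h3
        _ ≤ L ^ (1 - β / 2) * lam ^ (-(β / 2 / 2)) :=
          mul_le_mul_of_nonneg_left h2 (Real.rpow_nonneg hL0.le _)
    calc s ≤ L := htriv
      _ ≤ 1 * (L * lam ^ α' + L ^ (1 - β / 2) * lam ^ (-(β / 2 / 2))) := by linarith
      _ ≤ 8 * C * (L * lam ^ α' + L ^ (1 - β / 2) * lam ^ (-(β / 2 / 2))) :=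
          mul_le_mul_of_nonneg_right h8C (by positivity)
  · -- Sub-case `H₀ < L`: differencing
    set H : ℕ := ⌊H₀⌋₊ with hHdef
    have hH1 : 1 ≤ H := (Nat.one_le_floor_iff _).2 hH₀1
    have hHH₀ : (H : ℝ) ≤ H₀ := Nat.floor_le (by linarith)
    have hH₀H : H₀ < 2 * H := by
      have := Nat.lt_floor_add_one H₀
      have : (1 : ℝ) ≤ H := by exact_mod_cast hH1
      linarith
    have hHL : (H : ℤ) ≤ b - a := by
      have : (H : ℝ) < (b : ℝ) - a := lt_of_le_of_lt hHH₀ hLH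
      have : ((H : ℤ) : ℝ) < ((b - a : ℤ) : ℝ) := by push_cast; exact_mod_cast this
      exact (Int.cast_lt.1 this).le
    have hvdc := vanDerCorput_e (D 0) hH1 hHL
    -- bound for each differenced sum
    set Q : ℝ := L * ((H : ℝ) * lam) ^ α + L ^ (1 - β) * lam ^ (-(β / 2)) with hQ
    have hQ0 : 0 ≤ Q := by positivity
    have hSd : ∀ d ∈ Finset.Ico (1 : ℤ) H,
        ‖∑ n ∈ Finset.Ioc a (b - d), e (D 0 ((n + d : ℤ)) - D 0 n)‖ ≤ C * Q := by
      intro d hd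
      rw [Finset.mem_Ico] at hd
      have hd0 : (0 : ℝ) < d := by exact_mod_cast hd.1
      have hd1 : (1 : ℝ) ≤ d := by exact_mod_cast hd.1
      have hdH : (d : ℝ) ≤ H := by
        have : d + 1 ≤ H := hd.2
        have : ((d : ℤ) : ℝ) + 1 ≤ ((H : ℤ) : ℝ) := by exact_mod_cast this
        push_cast at this; linarith
      have habd : a < b - d := by omega
      -- the differenced family
      set Dd : ℕ → ℝ → ℝ := fun j y => D j (y + d) - D j y with hDd
      have hDd1 : DerivFamily Dd a ((b - d : ℤ) : ℝ) k := by
        have := (hD.mono (Nat.le_succ k)).diff (d := (d : ℝ)) hd0.le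
        push_cast
        exact this
      have hDd2 : ∀ y ∈ Set.Icc (a : ℝ) ((b - d : ℤ) : ℝ),
          (d : ℝ) * lam ≤ Dd k y ∧ Dd k y ≤ h * ((d : ℝ) * lam) := by
        intro y hy
        push_cast at hy
        exact hD.diff_bound hd0 hbound y hy
      have hK := HK ((d : ℝ) * lam) (by positivity) a (b - d) habd Dd hDd1 hDd2
      have hsum : ∑ n ∈ Finset.Ioc a (b - d), e (D 0 ((n + d : ℤ)) - D 0 n)
          = ∑ n ∈ Finset.Ioc a (b - d), e (Dd 0 n) := by
        refine Finset.sum_congr rfl fun n _ => ?_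
        simp only [hDd]; push_cast; ring_nf
      rw [hsum]
      refine hK.trans ?_
      apply mul_le_mul_of_nonneg_left _ (by linarith)
      have hLd : ((b - d : ℤ) : ℝ) - a = L - d := by push_cast; rw [hL]; ring
      rw [hLd]
      have hLd0 : 0 ≤ L - d := by
        have : ((b - d : ℤ) : ℝ) - a > 0 := by
          have : ((a : ℤ) : ℝ) < ((b - d : ℤ) : ℝ) := by exact_mod_cast habd
          linarith
        linarith
      have hLdL : L - d ≤ L := by linarith
      apply add_le_add
      · apply mul_le_mul hLdL _ (by positivity) hL0.le
        exact Real.rpow_le_rpow (by positivity) (by nlinarith) hα.le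
      · apply mul_le_mul _ _ (by positivity) (by positivity)
        · exact Real.rpow_le_rpow hLd0 hLdL (by linarith)
        · apply Real.rpow_le_rpow_of_nonpos hlam _ (by linarith)
          nlinarith
    -- sum over d
    have hT : ∑ d ∈ Finset.Ico (1 : ℤ) H, ‖∑ n ∈ Finset.Ioc a (b - d), e (D 0 ((n + d : ℤ)) - D 0 n)‖
        ≤ H * (C * Q) := by
      refine (Finset.sum_le_sum hSd).trans ?_
      rw [Finset.sum_const, nsmul_eq_mul, Int.card_Ico]
      apply mul_le_mul_of_nonneg_right _ (by positivity)
      have : (((H : ℤ) - 1).toNat : ℝ) ≤ H := by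
        have h1 : (((H : ℤ) - 1).toNat : ℤ) = (H : ℤ) - 1 := Int.toNat_of_nonneg (by omega)
        have h2 : ((((H : ℤ) - 1).toNat : ℕ) : ℝ) = (((H : ℤ) - 1 : ℤ) : ℝ) := by exact_mod_cast h1
        rw [h2]; push_cast; linarith
      exact this
    exact step_algebra hC hα hlam hL1 hH₀ hH1 hHH₀ hH₀H hvdc hT

/-- **The `k`-th derivative test** (van der Corput; cf. Titchmarsh Thm 5.13, Graham–Kolesnik
Thm 2.8): for every `k ≥ 2` and `h ≥ 1` there are `C ≥ 1`, `0 < α ≤ 1`, `0 < β ≤ 1` such that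
`‖∑_{a<n≤b} e(f(n))‖ ≤ C ((b-a) λ^α + (b-a)^{1-β} λ^{-β/2})` whenever `λ ≤ f^{(k)} ≤ hλ` on `[a, b]`.
[cite: GrahamKolesnik1991, Thm 2.8 (weak form: exponents unspecified; cf. Titchmarsh1986 Thm 5.13)] -/
theorem kth_deriv_test {h : ℝ} (hh : 1 ≤ h) (k : ℕ) (hk : 2 ≤ k) :
    ∃ C α β : ℝ, 1 ≤ C ∧ 0 < α ∧ α ≤ 1 ∧ 0 < β ∧ β ≤ 1 ∧ KBoundWith h k C α β := by
  induction k, hk using Nat.le_induction with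
  | base =>
    exact ⟨12 * h, 1 / 2, 1, by linarith, by norm_num, by norm_num, by norm_num, le_rfl,
      kbound_two hh⟩
  | succ k hk ih =>
    obtain ⟨C, α, β, hC, hα, hα1, hβ, hβ1, HK⟩ := ih
    refine ⟨8 * C, α / (2 * (1 + α)), β / 2, by linarith, by positivity, ?_, by positivity,
      by linarith, kbound_step hC hα hα1 hβ hβ1 HK⟩
    rw [div_le_iff₀ (by positivity)]; nlinarith

end VdC
end Literature.NumberTheory.LFunctions

/-! ## Part 5: the phase `f(y) = -(u/2π) log y` and power savings for `∑ n^{-iu}` -/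

namespace Literature.NumberTheory.LFunctions
namespace VdC

open Finset Real

/-- Sign wrapper: `KBoundWith` also bounds families with `λ ≤ ε D k ≤ h λ`, `ε = ±1`. [folklore] -/
theorem KBoundWith.signed {h : ℝ} {k : ℕ} {C α β : ℝ} (HK : KBoundWith h k C α β)
    {ε : ℝ} (hε : ε = 1 ∨ ε = -1) {lam : ℝ} (hlam : 0 < lam) {a b : ℤ} (hab : a < b)
    {D : ℕ → ℝ → ℝ} (hD : DerivFamily D a b k)
    (hbound : ∀ y ∈ Set.Icc (a : ℝ) b, lam ≤ ε * D k y ∧ ε * D k y ≤ h * lam) :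
    ‖∑ n ∈ Finset.Ioc a b, e (D 0 n)‖
      ≤ C * (((b : ℝ) - a) * lam ^ α + ((b : ℝ) - a) ^ (1 - β) * lam ^ (-(β / 2))) := by
  set D' : ℕ → ℝ → ℝ := fun j y => ε * D j y with hD'
  have hD'fam : DerivFamily D' a b k := fun j hj y hy => (hD j hj y hy).const_mul ε
  have hK := HK lam hlam a b hab D' hD'fam hbound
  have hnorm : ‖∑ n ∈ Finset.Ioc a b, e (D 0 n)‖ = ‖∑ n ∈ Finset.Ioc a b, e (D' 0 n)‖ := by
    rcases hε with h1 | h1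
    · simp [hD', h1]
    · have : ∑ n ∈ Finset.Ioc a b, e (D' 0 n)
          = (starRingEnd ℂ) (∑ n ∈ Finset.Ioc a b, e (D 0 n)) := by
        rw [map_sum]
        refine Finset.sum_congr rfl fun n _ => ?_
        simp only [hD', h1, neg_mul, one_mul]
        exact e_neg _
      rw [this, Complex.norm_conj]
  rw [hnorm]
  exact hK

/-- The derivative family of the phase `-(u/2π) log y`:
`D_j(y) = (u/2π) (-1)^j (j-1)! y^{-j}` for `j ≥ 1`. [folklore] -/
noncomputable def phaseD (u : ℝ) : ℕ → ℝ → ℝ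
  | 0 => fun y => -(u / (2 * π)) * Real.log y
  | (j + 1) => fun y => u / (2 * π) * (-1) ^ (j + 1) * (Nat.factorial j : ℝ) * y ^ (-((j : ℤ) + 1))

/-- `D₀(y) = -(u/2π) log y`. [folklore] -/
theorem phaseD_zero (u y : ℝ) : phaseD u 0 y = -(u / (2 * π)) * Real.log y := rfl

/-- `D_{j+1}(y) = (u/2π) (-1)^{j+1} j! y^{-(j+1)}`. [folklore] -/
theorem phaseD_succ (u : ℝ) (j : ℕ) (y : ℝ) :
    phaseD u (j + 1) y = u / (2 * π) * (-1) ^ (j + 1) * (Nat.factorial j : ℝ) * y ^ (-((j : ℤ) + 1)) :=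
  rfl

/-- `(-1)^{j+1} D_{j+1}(y) = (u/2π) j! / y^{j+1}`. [folklore] -/
theorem phaseD_succ' (u : ℝ) (j : ℕ) (y : ℝ) :
    (-1) ^ (j + 1) * phaseD u (j + 1) y = u / (2 * π) * (Nat.factorial j : ℝ) / y ^ (j + 1) := by
  rw [phaseD_succ, zpow_neg, ← Nat.cast_succ, zpow_natCast]
  have h1 : ((-1 : ℝ) ^ (j + 1)) * (-1) ^ (j + 1) = 1 := by
    rw [← mul_pow]; norm_num
  calc (-1) ^ (j + 1) * (u / (2 * π) * (-1) ^ (j + 1) * (Nat.factorial j : ℝ) * (y ^ (j + 1))⁻¹)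
      = ((-1 : ℝ) ^ (j + 1) * (-1) ^ (j + 1)) * (u / (2 * π) * (Nat.factorial j : ℝ) * (y ^ (j + 1))⁻¹) := by
        ring
    _ = u / (2 * π) * (Nat.factorial j : ℝ) / y ^ (j + 1) := by rw [h1, one_mul]; ring

/-- `e(D₀(n)) = n^{-iu}`. [folklore] -/
theorem e_phaseD_zero (u : ℝ) {n : ℕ} (hn : 0 < n) :
    e (phaseD u 0 n) = (n : ℂ) ^ (-(u * Complex.I)) := by
  rw [phaseD_zero, e, Complex.cpow_def_of_ne_zero (by exact_mod_cast hn.ne'),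
    ← Complex.ofReal_natCast, ← Complex.ofReal_log (by positivity)]
  congr 1
  have hπ : (π : ℂ) ≠ 0 := by exact_mod_cast Real.pi_ne_zero
  push_cast
  field_simp

/-- The phase family is a derivative family on `[a, b] ⊆ (0, ∞)`. [folklore] -/
theorem phaseD_derivFamily (u : ℝ) {a b : ℝ} (ha : 0 < a) (k : ℕ) :
    DerivFamily (phaseD u) a b k := by
  intro j _ y hy
  have hy0 : 0 < y := lt_of_lt_of_le ha hy.1
  rcases j with _ | j
  · -- j = 0
    show HasDerivAt (phaseD u 0) (phaseD u 1 y) y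
    have h1 : HasDerivAt (fun y => -(u / (2 * π)) * Real.log y) (-(u / (2 * π)) * y⁻¹) y :=
      (Real.hasDerivAt_log hy0.ne').const_mul _
    have h2 : phaseD u 1 y = -(u / (2 * π)) * y⁻¹ := by
      rw [phaseD_succ]; simp
    rw [h2]
    exact h1
  · show HasDerivAt (phaseD u (j + 1)) (phaseD u (j + 2) y) y
    have h1 : HasDerivAt (fun y : ℝ => u / (2 * π) * (-1) ^ (j + 1) * (Nat.factorial j : ℝ)
        * y ^ (-((j : ℤ) + 1)))
        (u / (2 * π) * (-1) ^ (j + 1) * (Nat.factorial j : ℝ)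
          * ((-((j : ℤ) + 1) : ℤ) * y ^ (-((j : ℤ) + 1) - 1))) y :=
      (hasDerivAt_zpow (-((j : ℤ) + 1)) y (Or.inl hy0.ne')).const_mul _
    have h2 : phaseD u (j + 2) y = u / (2 * π) * (-1) ^ (j + 1) * (Nat.factorial j : ℝ)
        * ((-((j : ℤ) + 1) : ℤ) * y ^ (-((j : ℤ) + 1) - 1)) := by
      rw [show j + 2 = (j + 1) + 1 from rfl, phaseD_succ, Nat.factorial_succ]
      have e2 : -(((j + 1 : ℕ) : ℤ) + 1) = -((j : ℤ) + 1) - 1 := by push_cast; ring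
      rw [e2]
      push_cast
      ring
    rw [h2]
    exact h1

/-- Size of the `k`-th derivative on `[N, 2N]`: with `λ = (u/2π)(k-1)!/(2N)^k`,
`λ ≤ (-1)^k D_k(y) ≤ 2^k λ`. [folklore] -/
theorem phaseD_bound (u : ℝ) (hu : 0 < u) {N : ℝ} (hN : 0 < N) (j : ℕ) {y : ℝ}
    (hy : y ∈ Set.Icc N (2 * N)) :
    u / (2 * π) * (Nat.factorial j : ℝ) / (2 * N) ^ (j + 1) ≤ (-1) ^ (j + 1) * phaseD u (j + 1) y
    ∧ (-1) ^ (j + 1) * phaseD u (j + 1) y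
      ≤ (2 : ℝ) ^ (j + 1) * (u / (2 * π) * (Nat.factorial j : ℝ) / (2 * N) ^ (j + 1)) := by
  have hy0 : 0 < y := lt_of_lt_of_le hN hy.1
  rw [phaseD_succ' u j y]
  have hc : 0 < u / (2 * π) * (Nat.factorial j : ℝ) := by
    have := Nat.factorial_pos j; positivity
  constructor
  · apply div_le_div_of_nonneg_left hc.le (by positivity)
    exact pow_le_pow_left₀ hy0.le hy.2 _
  · rw [show (2 : ℝ) ^ (j + 1) * (u / (2 * π) * (Nat.factorial j : ℝ) / (2 * N) ^ (j + 1))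
        = u / (2 * π) * (Nat.factorial j : ℝ) / N ^ (j + 1) by
      rw [mul_pow]; field_simp]
    apply div_le_div_of_nonneg_left hc.le (by positivity)
    exact pow_le_pow_left₀ hN.le hy.1 _

/-- **Power saving for `∑_{N<n≤x} n^{-iu}` in the range `N^{k-3/2} ≤ u ≤ N^{k-1/2}`** from the
`k`-th derivative test. [folklore] -/
theorem powerSaving_k (k : ℕ) (hk : 2 ≤ k) :
    ∃ C δ : ℝ, 0 < δ ∧ 0 ≤ C ∧ ∀ N : ℕ, 1 ≤ N → ∀ u : ℝ,
      (N : ℝ) ^ ((k : ℝ) - 3 / 2) ≤ u → u ≤ (N : ℝ) ^ ((k : ℝ) - 1 / 2) →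
      ∀ x : ℕ, N < x → x ≤ 2 * N →
        ‖∑ n ∈ Finset.Ioc (N : ℤ) x, e (phaseD u 0 n)‖ ≤ C * (N : ℝ) ^ (1 - δ) := by
  obtain ⟨j, rfl⟩ : ∃ j, k = j + 1 := ⟨k - 1, by omega⟩
  have hh : (1 : ℝ) ≤ (2 : ℝ) ^ (j + 1) := one_le_pow₀ (by norm_num)
  obtain ⟨C, α, β, hC, hα, hα1, hβ, hβ1, HK⟩ := kth_deriv_test hh (j + 1) hk
  -- the constant `c = j!/(2π 2^{j+1})` relating `λ` and `u N^{-(j+1)}`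
  set c : ℝ := (Nat.factorial j : ℝ) / (2 * π * 2 ^ (j + 1)) with hc
  have hc0 : 0 < c := by have := Nat.factorial_pos j; positivity
  set δ : ℝ := min (α / 2) (β / 4) with hδ
  have hδ0 : 0 < δ := lt_min (by linarith) (by linarith)
  refine ⟨C * (c ^ α + c ^ (-(β / 2))), δ, hδ0, by positivity, ?_⟩
  intro N hN u hu1 hu2 x hx1 hx2
  have hN0 : (0 : ℝ) < N := by exact_mod_cast hN
  have hN1 : (1 : ℝ) ≤ N := by exact_mod_cast hN
  have hkpos : (0 : ℝ) < (j + 1 : ℕ) - 3 / 2 + 1 := by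
    have : (2 : ℝ) ≤ (j + 1 : ℕ) := by exact_mod_cast hk
    linarith
  have hu0 : 0 < u := by
    have : (1 : ℝ) ≤ (N : ℝ) ^ (((j + 1 : ℕ) : ℝ) - 3 / 2) := Real.one_le_rpow hN1 (by
      have : (2 : ℝ) ≤ (j + 1 : ℕ) := by exact_mod_cast hk
      linarith)
    linarith
  -- λ and its range
  set lam : ℝ := u / (2 * π) * (Nat.factorial j : ℝ) / (2 * (N : ℝ)) ^ (j + 1) with hlam
  have hlam_eq : lam = c * (u * (N : ℝ) ^ (-((j : ℝ) + 1))) := by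
    rw [hlam, hc, Real.rpow_neg hN0.le, show (j : ℝ) + 1 = ((j + 1 : ℕ) : ℝ) by push_cast; ring,
      Real.rpow_natCast, mul_pow]
    field_simp
  have hlam0 : 0 < lam := by rw [hlam_eq]; positivity
  have hjr : ((j + 1 : ℕ) : ℝ) = (j : ℝ) + 1 := by push_cast; ring
  have hlam_up : lam ≤ c * (N : ℝ) ^ (-(1 / 2 : ℝ)) := by
    rw [hlam_eq]
    apply mul_le_mul_of_nonneg_left _ hc0.le
    calc u * (N : ℝ) ^ (-((j : ℝ) + 1)) ≤ (N : ℝ) ^ (((j + 1 : ℕ) : ℝ) - 1 / 2) * (N : ℝ) ^ (-((j : ℝ) + 1)) :=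
          mul_le_mul_of_nonneg_right hu2 (by positivity)
      _ = (N : ℝ) ^ (-(1 / 2 : ℝ)) := by
          rw [← Real.rpow_add hN0, hjr]; congr 1; ring
  have hlam_low : c * (N : ℝ) ^ (-(3 / 2 : ℝ)) ≤ lam := by
    rw [hlam_eq]
    apply mul_le_mul_of_nonneg_left _ hc0.le
    calc (N : ℝ) ^ (-(3 / 2 : ℝ)) = (N : ℝ) ^ (((j + 1 : ℕ) : ℝ) - 3 / 2) * (N : ℝ) ^ (-((j : ℝ) + 1)) := by
          rw [← Real.rpow_add hN0]; congr 1; push_cast; ring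
      _ ≤ u * (N : ℝ) ^ (-((j : ℝ) + 1)) := mul_le_mul_of_nonneg_right hu1 (by positivity)
  -- apply the k-th derivative test on `(N, x]`
  have hab : (N : ℤ) < x := by exact_mod_cast hx1
  have hfam : DerivFamily (phaseD u) ((N : ℤ) : ℝ) ((x : ℤ) : ℝ) (j + 1) :=
    phaseD_derivFamily u (by push_cast; exact hN0) _
  have hbound : ∀ y ∈ Set.Icc (((N : ℤ) : ℝ)) ((x : ℤ) : ℝ),
      lam ≤ (-1) ^ (j + 1) * phaseD u (j + 1) y ∧ (-1) ^ (j + 1) * phaseD u (j + 1) y ≤ 2 ^ (j + 1) * lam := by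
    intro y hy
    have hy' : y ∈ Set.Icc (N : ℝ) (2 * N) := by
      push_cast at hy
      refine ⟨hy.1, hy.2.trans ?_⟩
      exact_mod_cast hx2
    exact phaseD_bound u hu0 hN0 j hy'
  have hε : ((-1 : ℝ) ^ (j + 1) = 1) ∨ ((-1 : ℝ) ^ (j + 1) = -1) := by
    rcases neg_one_pow_eq_or ℝ (j + 1) with h | h
    · exact Or.inl h
    · exact Or.inr h
  have hK := HK.signed hε hlam0 hab hfam hbound
  refine hK.trans ?_
  -- bookkeeping: L = x - N ≤ N, λ ∈ [c N^{-3/2}, c N^{-1/2}]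
  have hL : ((x : ℤ) : ℝ) - ((N : ℤ) : ℝ) ≤ N := by
    push_cast
    have : (x : ℝ) ≤ 2 * N := by exact_mod_cast hx2
    linarith
  have hL1 : 1 ≤ ((x : ℤ) : ℝ) - ((N : ℤ) : ℝ) := by
    push_cast
    have : (N : ℝ) + 1 ≤ x := by exact_mod_cast hx1
    linarith
  set L : ℝ := ((x : ℤ) : ℝ) - ((N : ℤ) : ℝ) with hLdef
  have hT1 : L * lam ^ α ≤ c ^ α * (N : ℝ) ^ (1 - δ) := by
    calc L * lam ^ α ≤ N * (c * (N : ℝ) ^ (-(1 / 2 : ℝ))) ^ α :=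
          mul_le_mul hL (Real.rpow_le_rpow hlam0.le hlam_up hα.le) (by positivity) hN0.le
      _ = c ^ α * (N : ℝ) ^ (1 - α / 2) := by
          rw [Real.mul_rpow hc0.le (by positivity), ← Real.rpow_mul hN0.le,
            Real.rpow_sub hN0, Real.rpow_one]
          have : -(1 / 2 : ℝ) * α = -(α / 2) := by ring
          rw [this, Real.rpow_neg hN0.le]
          field_simp
      _ ≤ c ^ α * (N : ℝ) ^ (1 - δ) := by
          apply mul_le_mul_of_nonneg_left _ (by positivity)
          apply Real.rpow_le_rpow_of_exponent_le hN1
          have : δ ≤ α / 2 := min_le_left _ _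
          linarith
  have hT2 : L ^ (1 - β) * lam ^ (-(β / 2)) ≤ c ^ (-(β / 2)) * (N : ℝ) ^ (1 - δ) := by
    have h1 : L ^ (1 - β) ≤ (N : ℝ) ^ (1 - β) := Real.rpow_le_rpow (by linarith) hL (by linarith)
    have h2 : lam ^ (-(β / 2)) ≤ (c * (N : ℝ) ^ (-(3 / 2 : ℝ))) ^ (-(β / 2)) :=
      Real.rpow_le_rpow_of_nonpos (by positivity) hlam_low (by linarith)
    calc L ^ (1 - β) * lam ^ (-(β / 2)) ≤ (N : ℝ) ^ (1 - β) * (c * (N : ℝ) ^ (-(3 / 2 : ℝ))) ^ (-(β / 2)) :=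
          mul_le_mul h1 h2 (by positivity) (by positivity)
      _ = c ^ (-(β / 2)) * (N : ℝ) ^ (1 - β / 4) := by
          rw [Real.mul_rpow hc0.le (by positivity), ← Real.rpow_mul hN0.le]
          have : (N : ℝ) ^ (1 - β) * (N : ℝ) ^ (-(3 / 2 : ℝ) * -(β / 2)) = (N : ℝ) ^ (1 - β / 4) := by
            rw [← Real.rpow_add hN0]; congr 1; ring
          rw [← this]; ring
      _ ≤ c ^ (-(β / 2)) * (N : ℝ) ^ (1 - δ) := by
          apply mul_le_mul_of_nonneg_left _ (by positivity)
          apply Real.rpow_le_rpow_of_exponent_le hN1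
          have : δ ≤ β / 4 := min_le_right _ _
          linarith
  calc C * (L * lam ^ α + L ^ (1 - β) * lam ^ (-(β / 2)))
      ≤ C * (c ^ α * (N : ℝ) ^ (1 - δ) + c ^ (-(β / 2)) * (N : ℝ) ^ (1 - δ)) := by
        apply mul_le_mul_of_nonneg_left (add_le_add hT1 hT2) (by linarith)
    _ = C * (c ^ α + c ^ (-(β / 2))) * (N : ℝ) ^ (1 - δ) := by ring

/-- **Power saving for `∑_{N<n≤x} n^{-iu}`, `√N ≤ u ≤ N^{K + 1/2}`** (all `k`-th derivative tests,
`2 ≤ k ≤ K + 1`). [folklore] -/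
theorem powerSaving (K : ℕ) (hK : 1 ≤ K) :
    ∃ C δ : ℝ, 0 < δ ∧ 0 ≤ C ∧ ∀ N : ℕ, 1 ≤ N → ∀ u : ℝ,
      (N : ℝ) ^ (1 / 2 : ℝ) ≤ u → u ≤ (N : ℝ) ^ ((K : ℝ) + 1 / 2) →
      ∀ x : ℕ, N < x → x ≤ 2 * N →
        ‖∑ n ∈ Finset.Ioc (N : ℤ) x, e (phaseD u 0 n)‖ ≤ C * (N : ℝ) ^ (1 - δ) := by
  induction K, hK using Nat.le_induction with
  | base =>
    obtain ⟨C, δ, hδ, hC, h⟩ := powerSaving_k 2 le_rfl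
    refine ⟨C, δ, hδ, hC, fun N hN u hu1 hu2 x hx1 hx2 => h N hN u ?_ ?_ x hx1 hx2⟩
    · convert hu1 using 2; norm_num
    · convert hu2 using 2; norm_num
  | succ K hK ih =>
    obtain ⟨C₁, δ₁, hδ₁, hC₁, h₁⟩ := ih
    obtain ⟨C₂, δ₂, hδ₂, hC₂, h₂⟩ := powerSaving_k (K + 2) (by omega)
    refine ⟨max C₁ C₂, min δ₁ δ₂, lt_min hδ₁ hδ₂, le_max_of_le_left hC₁, ?_⟩
    intro N hN u hu1 hu2 x hx1 hx2
    have hN1 : (1 : ℝ) ≤ N := by exact_mod_cast hN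
    have hmono : ∀ {C' δ' : ℝ}, C' ≤ max C₁ C₂ → min δ₁ δ₂ ≤ δ' → 0 ≤ C' →
        C' * (N : ℝ) ^ (1 - δ') ≤ max C₁ C₂ * (N : ℝ) ^ (1 - min δ₁ δ₂) := by
      intro C' δ' hC' hδ' hC'0
      apply mul_le_mul hC' _ (by positivity) (le_trans hC'0 hC')
      exact Real.rpow_le_rpow_of_exponent_le hN1 (by linarith)
    rcases le_or_gt u ((N : ℝ) ^ ((K : ℝ) + 1 / 2)) with hu | hu
    · exact (h₁ N hN u hu1 hu x hx1 hx2).trans (hmono (le_max_left _ _) (min_le_left _ _) hC₁)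
    · refine (h₂ N hN u ?_ ?_ x hx1 hx2).trans (hmono (le_max_right _ _) (min_le_right _ _) hC₂)
      · refine le_trans (le_of_eq ?_) hu.le
        congr 1; push_cast; ring
      · refine hu2.trans (le_of_eq ?_)
        congr 1; push_cast; ring

end VdC
end Literature.NumberTheory.LFunctions

/-! ## Part 6: `‖ζ(σ + iu)‖ ≤ log u / K + O_K(1)` for `1 < σ ≤ 2` -/

namespace Literature.NumberTheory.LFunctions
namespace VdC

open Finset Real

/-- Transfer of a sum over `(N, x] ⊆ ℤ` with natural endpoints to a sum over naturals. [folklore] -/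
theorem sum_Ioc_int_eq_nat (F : ℤ → ℂ) (N x : ℕ) :
    ∑ n ∈ Finset.Ioc (N : ℤ) x, F n = ∑ n ∈ Finset.Ioc N x, F (n : ℤ) := by
  have hI : Finset.Ioc (N : ℤ) x = (Finset.Ioc N x).image (fun n : ℕ => (n : ℤ)) := by
    ext n
    simp only [Finset.mem_Ioc, Finset.mem_image]
    constructor
    · rintro ⟨h1, h2⟩
      exact ⟨n.toNat, ⟨by omega, by omega⟩, by omega⟩
    · rintro ⟨m, ⟨h1, h2⟩, rfl⟩
      exact ⟨by exact_mod_cast h1, by exact_mod_cast h2⟩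
  rw [hI, Finset.sum_image]
  intro a _ b _ h
  exact_mod_cast (show ((a : ℕ) : ℤ) = b from h)

/-- Transfer of a sum over `[N, x] ⊆ ℤ` with natural endpoints to a sum over naturals. [folklore] -/
theorem sum_Icc_int_eq_nat (F : ℤ → ℂ) (N x : ℕ) :
    ∑ n ∈ Finset.Icc (N : ℤ) x, F n = ∑ n ∈ Finset.Icc N x, F (n : ℤ) := by
  have hI : Finset.Icc (N : ℤ) x = (Finset.Icc N x).image (fun n : ℕ => (n : ℤ)) := by
    ext n
    simp only [Finset.mem_Icc, Finset.mem_image]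
    constructor
    · rintro ⟨h1, h2⟩
      exact ⟨n.toNat, ⟨by omega, by omega⟩, by omega⟩
    · rintro ⟨m, ⟨h1, h2⟩, rfl⟩
      exact ⟨by exact_mod_cast h1, by exact_mod_cast h2⟩
  rw [hI, Finset.sum_image]
  intro a _ b _ h
  exact_mod_cast (show ((a : ℕ) : ℤ) = b from h)

/-- **Abel summation bound**: for weights `w` nonincreasing and nonnegative on `(N, N+m]`
(and `w(N+1) ≥ 0`), and partial sums of `a` bounded by `B ≥ 0` there,
`‖∑_{N<n≤N+m} w(n) a(n)‖ ≤ w(N+1) B`. [folklore] -/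
theorem abel_bound (a : ℕ → ℂ) (N : ℕ) {B : ℝ} (hB : 0 ≤ B) :
    ∀ (m : ℕ) (w : ℕ → ℝ),
      (∀ n₁ n₂, N < n₁ → n₁ ≤ n₂ → n₂ ≤ N + m → w n₂ ≤ w n₁) →
      (∀ n, N < n → n ≤ N + m → 0 ≤ w n) → 0 ≤ w (N + 1) →
      (∀ x, N < x → x ≤ N + m → ‖∑ n ∈ Finset.Ioc N x, a n‖ ≤ B) →
      ‖∑ n ∈ Finset.Ioc N (N + m), (w n : ℂ) * a n‖ ≤ w (N + 1) * B := by
  intro m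
  induction m with
  | zero =>
    intro w _ _ hw1 _
    rw [add_zero, Finset.Ioc_self, sum_empty, norm_zero]
    exact mul_nonneg hw1 hB
  | succ m ih =>
    intro w hanti hnonneg hw1 hpart
    set c : ℝ := w (N + m + 1) with hc
    have hc0 : 0 ≤ c := hnonneg _ (by omega) (by omega)
    have hsplit : ∑ n ∈ Finset.Ioc N (N + (m + 1)), (w n : ℂ) * a n
        = ∑ n ∈ Finset.Ioc N (N + m), ((w n - c : ℝ) : ℂ) * a n
          + (c : ℂ) * ∑ n ∈ Finset.Ioc N (N + (m + 1)), a n := by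
      rw [Finset.mul_sum]
      have h1 : ∑ n ∈ Finset.Ioc N (N + (m + 1)), (w n : ℂ) * a n
          = ∑ n ∈ Finset.Ioc N (N + (m + 1)), (((w n - c : ℝ) : ℂ) * a n + (c : ℂ) * a n) := by
        refine Finset.sum_congr rfl fun n _ => ?_
        push_cast; ring
      rw [h1, Finset.sum_add_distrib, show N + (m + 1) = N + m + 1 by ring,
        Finset.sum_Ioc_succ_top (by omega : N ≤ N + m)]
      simp [hc]
    rw [hsplit]
    have hIH := ih (fun n => w n - c)
      (fun n₁ n₂ h1 h2 h3 => by linarith [hanti n₁ n₂ h1 h2 (by omega)])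
      (fun n h1 h2 => by linarith [hanti n (N + m + 1) h1 (by omega) (by omega)])
      (by linarith [hanti (N + 1) (N + m + 1) (by omega) (by omega) (by omega)])
      (fun x h1 h2 => hpart x h1 (by omega))
    have h2 : ‖(c : ℂ) * ∑ n ∈ Finset.Ioc N (N + (m + 1)), a n‖ ≤ c * B := by
      rw [norm_mul, Complex.norm_real, Real.norm_eq_abs, abs_of_nonneg hc0]
      exact mul_le_mul_of_nonneg_left (hpart _ (by omega) le_rfl) hc0
    calc _ ≤ ‖∑ n ∈ Finset.Ioc N (N + m), ((w n - c : ℝ) : ℂ) * a n‖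
          + ‖(c : ℂ) * ∑ n ∈ Finset.Ioc N (N + (m + 1)), a n‖ := norm_add_le _ _
      _ ≤ (w (N + 1) - c) * B + c * B := add_le_add hIH h2
      _ = w (N + 1) * B := by ring

/-- Abel bound with the weights `n^{-σ}`, `σ ≥ 0`: `‖∑_{N<n≤x} n^{-σ} a(n)‖ ≤ B / (N+1)^σ`.
[folklore] -/
theorem abel_bound_rpow (a : ℕ → ℂ) {N x : ℕ} (hNx : N ≤ x) {σ B : ℝ} (hσ : 0 ≤ σ) (hB : 0 ≤ B)
    (hpart : ∀ y, N < y → y ≤ x → ‖∑ n ∈ Finset.Ioc N y, a n‖ ≤ B) :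
    ‖∑ n ∈ Finset.Ioc N x, (((n : ℝ) ^ (-σ) : ℝ) : ℂ) * a n‖ ≤ ((N : ℝ) + 1) ^ (-σ) * B := by
  obtain ⟨m, rfl⟩ : ∃ m, x = N + m := ⟨x - N, by omega⟩
  have hanti : ∀ n₁ n₂ : ℕ, N < n₁ → n₁ ≤ n₂ → n₂ ≤ N + m →
      (n₂ : ℝ) ^ (-σ) ≤ (n₁ : ℝ) ^ (-σ) := by
    intro n₁ n₂ h1 h2 _
    have h0 : (0 : ℝ) < n₁ := by exact_mod_cast (Nat.zero_lt_of_lt h1)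
    exact Real.rpow_le_rpow_of_nonpos h0 (by exact_mod_cast h2) (by linarith)
  have := abel_bound a N hB m (fun n => (n : ℝ) ^ (-σ)) hanti
    (fun n _ _ => by positivity) (by positivity) (fun y h1 h2 => hpart y h1 h2)
  have e : ((N + 1 : ℕ) : ℝ) = (N : ℝ) + 1 := by push_cast; ring
  rw [e] at this
  exact this

/-- **Kusmin–Landau block for `n^{-iu}`**: for `u ≥ 2` and integers `u < m ≤ M ≤ 6u`,
`‖∑_{m ≤ n ≤ M} n^{-iu}‖ ≤ 24π` (in the `e(D₀ n)` normalisation). [folklore] -/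
theorem kl_block {u : ℝ} (hu : 2 ≤ u) {m M : ℕ} (hm : u < m) (hM : (M : ℝ) ≤ 6 * u) :
    ‖∑ n ∈ Finset.Icc (m : ℤ) M, e (phaseD u 0 n)‖ ≤ 24 * π := by
  have hπ : 3 < π := Real.pi_gt_three
  have hδ : (0 : ℝ) < 1 / (12 * π) := by positivity
  have hδ2 : 1 / (12 * π) ≤ 1 / 2 := by
    rw [div_le_div_iff₀ (by positivity) (by norm_num)]; nlinarith
  have hu0 : 0 < u := by linarith
  have key := kusminLandau (φ := fun n : ℤ => phaseD u 0 n) (m := m) (M := M) (ν := -1) hδ hδ2 ?_ ?_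
  · calc ‖∑ n ∈ Finset.Icc (m : ℤ) M, e (phaseD u 0 n)‖ ≤ 2 / (1 / (12 * π)) := key
      _ = 24 * π := by field_simp; ring
  · -- increments in [-1 + δ, -δ]
    intro n h1 h2
    have hn0 : (0 : ℝ) < n := by
      have : (m : ℝ) ≤ n := by exact_mod_cast h1
      linarith
    have hnu : u < n := by
      have : (m : ℝ) ≤ n := by exact_mod_cast h1
      linarith
    have hn1M : (n : ℝ) + 1 ≤ 6 * u := by
      have : n + 1 ≤ (M : ℤ) := h2
      have : ((n : ℤ) : ℝ) + 1 ≤ ((M : ℤ) : ℝ) := by exact_mod_cast this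
      push_cast at this; linarith
    have hlog_up : Real.log (((n : ℝ) + 1) / n) ≤ 1 / n := by
      have := Real.log_le_sub_one_of_pos (by positivity : (0 : ℝ) < ((n : ℝ) + 1) / n)
      rwa [show ((n : ℝ) + 1) / n - 1 = 1 / n by field_simp; ring] at this
    have hlog_low : 1 / ((n : ℝ) + 1) ≤ Real.log (((n : ℝ) + 1) / n) := by
      have := Real.one_sub_inv_le_log_of_pos (by positivity : (0 : ℝ) < ((n : ℝ) + 1) / n)
      rwa [show 1 - (((n : ℝ) + 1) / n)⁻¹ = 1 / ((n : ℝ) + 1) by field_simp; ring] at this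
    have hθ : phaseD u 0 ((n + 1 : ℤ) : ℝ) - phaseD u 0 n
        = -(u / (2 * π)) * Real.log (((n : ℝ) + 1) / n) := by
      rw [phaseD_zero, phaseD_zero, Real.log_div (by positivity) hn0.ne']
      push_cast; ring
    rw [hθ]
    have hc : 0 < u / (2 * π) := by positivity
    constructor
    · -- -1 + δ ≤ -(u/2π) log(1 + 1/n), from log ≤ 1/n < 1/u
      have h3 : u / (2 * π) * Real.log (((n : ℝ) + 1) / n) ≤ 1 / (2 * π) := by
        calc u / (2 * π) * Real.log (((n : ℝ) + 1) / n) ≤ u / (2 * π) * (1 / n) :=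
              mul_le_mul_of_nonneg_left hlog_up hc.le
          _ ≤ u / (2 * π) * (1 / u) := by
              apply mul_le_mul_of_nonneg_left _ hc.le
              exact one_div_le_one_div_of_le hu0 hnu.le
          _ = 1 / (2 * π) := by field_simp
      have h4 : (1 : ℝ) / (2 * π) + 1 / (12 * π) ≤ 1 := by
        rw [div_add_div _ _ (by positivity) (by positivity), div_le_one (by positivity)]
        nlinarith
      push_cast
      linarith
    · -- -(u/2π) log(1+1/n) ≤ -δ, from log ≥ 1/(n+1) ≥ 1/(6u)
      have h3 : 1 / (12 * π) ≤ u / (2 * π) * Real.log (((n : ℝ) + 1) / n) := by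
        calc 1 / (12 * π) = u / (2 * π) * (1 / (6 * u)) := by field_simp; ring
          _ ≤ u / (2 * π) * (1 / ((n : ℝ) + 1)) := by
              apply mul_le_mul_of_nonneg_left _ hc.le
              exact one_div_le_one_div_of_le (by positivity) hn1M
          _ ≤ u / (2 * π) * Real.log (((n : ℝ) + 1) / n) :=
              mul_le_mul_of_nonneg_left hlog_low hc.le
      push_cast
      linarith
  · -- monotonicity of increments (concavity of log)
    intro n h1 h2
    have hn0 : (0 : ℝ) < n := by
      have : (m : ℝ) ≤ n := by exact_mod_cast h1
      linarith
    have hc : 0 < u / (2 * π) := by positivity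
    simp only [phaseD_zero]
    push_cast
    have hlog : Real.log ((n : ℝ) + 2) + Real.log n ≤ 2 * Real.log ((n : ℝ) + 1) := by
      rw [← Real.log_mul (by positivity) hn0.ne', ← Real.log_rpow (by positivity),
        Real.rpow_two]
      exact Real.log_le_log (by positivity) (by nlinarith)
    nlinarith [hlog, hc]

/-- **Dyadic decomposition**: if every dyadic block `(M 2^i, min(M 2^{i+1}, U)]` with
`M 2^i < U` has `‖block sum‖ ≤ G(M 2^i)` (`G ≥ 0`), then
`‖∑_{M<n≤U} g(n)‖ ≤ ∑_{i<I} G(M 2^i)` whenever `U ≤ M 2^I`. [folklore] -/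
theorem dyadic_bound (g : ℕ → ℂ) (G : ℕ → ℝ) (hG : ∀ N, 0 ≤ G N) (U : ℕ) :
    ∀ (I M : ℕ), (∀ i : ℕ, M * 2 ^ i < U →
        ‖∑ n ∈ Finset.Ioc (M * 2 ^ i) (min (M * 2 ^ (i + 1)) U), g n‖ ≤ G (M * 2 ^ i)) →
      U ≤ M * 2 ^ I → ‖∑ n ∈ Finset.Ioc M U, g n‖ ≤ ∑ i ∈ Finset.range I, G (M * 2 ^ i) := by
  intro I
  induction I with
  | zero =>
    intro M _ hU
    rw [pow_zero, mul_one] at hU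
    rw [Finset.Ioc_eq_empty (by omega), sum_empty, norm_zero, Finset.range_zero, sum_empty]
  | succ I ih =>
    intro M hblock hU
    rcases le_or_gt U (M * 2) with hU2 | hU2
    · -- a single block (or empty)
      rcases le_or_gt U M with hUM | hUM
      · rw [Finset.Ioc_eq_empty (by omega), sum_empty, norm_zero]
        exact Finset.sum_nonneg fun i _ => hG _
      · have h0 := hblock 0 (by simpa using hUM)
        rw [pow_zero, mul_one, zero_add, pow_one, min_eq_right hU2] at h0
        refine h0.trans ?_
        rw [Finset.sum_range_succ']
        simp only [pow_zero, mul_one]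
        have : 0 ≤ ∑ i ∈ Finset.range I, G (M * 2 ^ (i + 1)) := Finset.sum_nonneg fun i _ => hG _
        linarith
    · -- split off the first block and recurse with `2M`
      have h0 := hblock 0 (by simp; omega)
      rw [pow_zero, mul_one, zero_add, pow_one, min_eq_left hU2.le] at h0
      have hrec := ih (M * 2) (fun i hi => by
        have e1 : M * 2 * 2 ^ i = M * 2 ^ (i + 1) := by ring
        have e2 : M * 2 * 2 ^ (i + 1) = M * 2 ^ (i + 1 + 1) := by ring
        rw [e1, e2]
        exact hblock (i + 1) (by rw [← e1]; exact hi)) (by rw [mul_assoc, ← pow_succ']; exact hU)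
      rw [← Finset.sum_Ioc_consecutive g (by omega : M ≤ M * 2) hU2.le, Finset.sum_range_succ']
      simp only [pow_zero, mul_one]
      calc ‖∑ n ∈ Finset.Ioc M (M * 2), g n + ∑ n ∈ Finset.Ioc (M * 2) U, g n‖
          ≤ ‖∑ n ∈ Finset.Ioc M (M * 2), g n‖ + ‖∑ n ∈ Finset.Ioc (M * 2) U, g n‖ := norm_add_le _ _
        _ ≤ G M + ∑ i ∈ Finset.range I, G (M * 2 * 2 ^ i) := add_le_add h0 hrec
        _ = ∑ i ∈ Finset.range I, G (M * 2 ^ (i + 1)) + G M := by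
            rw [add_comm]; congr 1
            refine Finset.sum_congr rfl fun i _ => ?_
            congr 1; ring

/-! ### The tail `ζ(s) - ∑_{n ≤ U} n^{-s}` for `U ≥ 2 Im s` -/

section tail

open Complex

variable {s : ℂ}

/-- The derivative of `w ↦ w^{-s}` on `(0, ∞)`. [folklore] -/
theorem hasDerivAt_ofReal_cpow_neg (hs : s ≠ 0) {w : ℝ} (hw : 0 < w) :
    HasDerivAt (fun w : ℝ => (w : ℂ) ^ (-s)) (-s * (w : ℂ) ^ (-s - 1)) w := by
  have h1 := hasDerivAt_ofReal_cpow_const' (x := w) hw.ne' (r := -s - 1) (by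
    intro h; apply hs; linear_combination -h)
  have h2 : (fun y : ℝ => (y : ℂ) ^ (-s - 1 + 1) / (-s - 1 + 1)) = fun y : ℝ => (y : ℂ) ^ (-s) / (-s) := by
    funext y; rw [sub_add_cancel]
  rw [h2] at h1
  have h3 := h1.const_mul (-s)
  have h4 : (fun y : ℝ => -s * ((y : ℂ) ^ (-s) / (-s))) = fun y : ℝ => (y : ℂ) ^ (-s) := by
    funext y; field_simp [neg_ne_zero.2 hs]
  rw [h4] at h3
  exact h3

/-- The derivative of `G(w) = w^{1-s}/(1-s)` on `(0, ∞)` is `w^{-s}`. [folklore] -/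
theorem hasDerivAt_G (hs : s ≠ 1) {w : ℝ} (hw : 0 < w) :
    HasDerivAt (fun w : ℝ => (w : ℂ) ^ (-s + 1) / (-s + 1)) ((w : ℂ) ^ (-s)) w :=
  hasDerivAt_ofReal_cpow_const' hw.ne' (by intro h; apply hs; linear_combination -h)

/-- `‖N^{-s} - y^{-s}‖ ≤ ‖s‖ y₀^{-Re s - 1} (N - y)` for `1 ≤ y₀ ≤ y ≤ N`, `Re s > 0`. [folklore] -/
theorem norm_cpow_neg_sub_le (hσ : 0 < s.re) {y₀ N : ℝ} (hy₀ : 1 ≤ y₀)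
    {y : ℝ} (hy : y ∈ Set.Icc y₀ N) :
    ‖((N : ℂ) ^ (-s)) - ((y : ℂ) ^ (-s))‖ ≤ ‖s‖ * y₀ ^ (-s.re - 1) * (N - y) := by
  have hs : s ≠ 0 := by intro h; rw [h] at hσ; simp at hσ
  have hseg := norm_image_sub_le_of_norm_deriv_le_segment' (f := fun w : ℝ => (w : ℂ) ^ (-s))
    (f' := fun w => -s * (w : ℂ) ^ (-s - 1)) (a := y) (b := N) (C := ‖s‖ * y₀ ^ (-s.re - 1))
    (fun w hw => (hasDerivAt_ofReal_cpow_neg hs (by linarith [hw.1, hy.1])).hasDerivWithinAt)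
    (fun w hw => by
      have hw0 : 0 < w := by linarith [hw.1, hy.1]
      rw [norm_mul, norm_neg, Complex.norm_cpow_eq_rpow_re_of_pos hw0]
      apply mul_le_mul_of_nonneg_left _ (norm_nonneg _)
      have : (-s - 1).re = -s.re - 1 := by simp
      rw [this]
      exact Real.rpow_le_rpow_of_nonpos (by linarith) (by linarith [hw.1, hy.1]) (by linarith))
    N ⟨hy.2, le_rfl⟩
  simpa [norm_sub_rev] using hseg

/-- One telescoping step: `‖N^{-s} - (G(N) - G(N-1))‖ ≤ ‖s‖ (N-1)^{-Re s - 1}` for `N ≥ 2`.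
[folklore] -/
theorem norm_term_sub_G_le (hσ : 0 < s.re) (hs1 : s ≠ 1) {N : ℝ} (hN : 2 ≤ N) :
    ‖((N : ℂ) ^ (-s)) - (((N : ℂ) ^ (-s + 1) / (-s + 1)) - (((N - 1 : ℝ) : ℂ) ^ (-s + 1) / (-s + 1)))‖
      ≤ ‖s‖ * (N - 1) ^ (-s.re - 1) := by
  set G : ℝ → ℂ := fun w => (w : ℂ) ^ (-s + 1) / (-s + 1) with hG
  set ψ : ℝ → ℂ := fun y => ((y - (N - 1) : ℝ) : ℂ) * (N : ℂ) ^ (-s) - (G y - G (N - 1)) with hψ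
  have hψ' : ∀ y ∈ Set.Icc (N - 1) N,
      HasDerivWithinAt ψ ((N : ℂ) ^ (-s) - (y : ℂ) ^ (-s)) (Set.Icc (N - 1) N) y := by
    intro y hy
    have hy0 : 0 < y := by linarith [hy.1]
    apply HasDerivAt.hasDerivWithinAt
    have h1 : HasDerivAt (fun y : ℝ => ((y - (N - 1) : ℝ) : ℂ) * (N : ℂ) ^ (-s)) ((1 : ℂ) * (N : ℂ) ^ (-s)) y := by
      apply HasDerivAt.mul_const
      have : HasDerivAt (fun y : ℝ => y - (N - 1)) 1 y := (hasDerivAt_id y).sub_const _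
      exact this.ofReal_comp
    have h2 : HasDerivAt (fun y : ℝ => G y - G (N - 1)) ((y : ℂ) ^ (-s)) y :=
      (hasDerivAt_G hs1 hy0).sub_const _
    have h3 := h1.sub h2
    rw [one_mul] at h3
    exact h3
  have hbound : ∀ y ∈ Set.Ico (N - 1) N, ‖(N : ℂ) ^ (-s) - (y : ℂ) ^ (-s)‖ ≤ ‖s‖ * (N - 1) ^ (-s.re - 1) := by
    intro y hy
    have h := norm_cpow_neg_sub_le hσ (y₀ := N - 1) (N := N) (by linarith)
      (y := y) ⟨hy.1, hy.2.le⟩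
    refine h.trans ?_
    have h0 : 0 ≤ ‖s‖ * (N - 1) ^ (-s.re - 1) :=
      mul_nonneg (norm_nonneg _) (Real.rpow_nonneg (by linarith) _)
    have h1 : N - y ≤ 1 := by linarith [hy.1]
    calc ‖s‖ * (N - 1) ^ (-s.re - 1) * (N - y) ≤ ‖s‖ * (N - 1) ^ (-s.re - 1) * 1 :=
          mul_le_mul_of_nonneg_left h1 h0
      _ = _ := mul_one _
  have hseg := norm_image_sub_le_of_norm_deriv_le_segment' hψ' hbound N ⟨by linarith, le_rfl⟩
  have e1 : ψ (N - 1) = 0 := by simp [hψ]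
  have e2 : ψ N = (N : ℂ) ^ (-s) - (G N - G (N - 1)) := by
    simp only [hψ]
    have : ((N - (N - 1) : ℝ) : ℂ) = 1 := by push_cast; ring
    rw [this, one_mul]
  rw [e1, sub_zero, e2, show N - (N - 1) = (1 : ℝ) by ring, mul_one] at hseg
  simpa [hG] using hseg

/-- `‖G(y)‖ ≤ 1/|Im s|` for `y ≥ 1`, `Re s ≥ 1`. [folklore] -/
theorem norm_G_le (hσ : 1 ≤ s.re) (him : s.im ≠ 0) {y : ℝ} (hy : 1 ≤ y) :
    ‖(y : ℂ) ^ (-s + 1) / (-s + 1)‖ ≤ 1 / |s.im| := by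
  have hy0 : 0 < y := by linarith
  rw [norm_div, Complex.norm_cpow_eq_rpow_re_of_pos hy0]
  have h1 : y ^ ((-s + 1).re) ≤ 1 := by
    apply Real.rpow_le_one_of_one_le_of_nonpos hy
    simp; linarith
  have h2 : |s.im| ≤ ‖-s + 1‖ := by
    have := Complex.abs_im_le_norm (-s + 1)
    simpa using this
  have h3 : 0 < |s.im| := abs_pos.2 him
  calc y ^ ((-s + 1).re) / ‖-s + 1‖ ≤ 1 / ‖-s + 1‖ :=
        div_le_div_of_nonneg_right h1 (norm_nonneg _)
    _ ≤ 1 / |s.im| := one_div_le_one_div_of_le h3 h2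

/-- Finite tail sums: for `1 < Re s ≤ 2`, `Im s ≥ 2`, `U ≥ 2 Im s`,
`‖∑_{i<V} (U+1+i)^{-s}‖ ≤ 7/3`. [folklore] -/
theorem norm_tail_partial_le (hσ1 : 1 < s.re) (hσ2 : s.re ≤ 2) (hu : 2 ≤ s.im) {U : ℕ}
    (hU : 2 * s.im ≤ U) (V : ℕ) :
    ‖∑ i ∈ Finset.range V, (((U + 1 + i : ℕ) : ℂ)) ^ (-s)‖ ≤ 7 / 3 := by
  have hs1 : s ≠ 1 := by intro h; rw [h] at hu; simp at hu; linarith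
  have hσ0 : 0 < s.re := by linarith
  have him : s.im ≠ 0 := by linarith
  have hU4 : (4 : ℝ) ≤ U := by linarith
  set G : ℝ → ℂ := fun w => (w : ℂ) ^ (-s + 1) / (-s + 1) with hG
  -- telescoping decomposition
  have hdecomp : ∑ i ∈ Finset.range V, (((U + 1 + i : ℕ) : ℂ)) ^ (-s)
      = ∑ i ∈ Finset.range V, ((((U + 1 + i : ℕ) : ℂ)) ^ (-s) - (G ((U : ℝ) + i + 1) - G ((U : ℝ) + i)))
        + (G ((U : ℝ) + V) - G U) := by
    rw [Finset.sum_sub_distrib]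
    have htel : ∑ i ∈ Finset.range V, (G ((U : ℝ) + i + 1) - G ((U : ℝ) + i)) = G ((U : ℝ) + V) - G U := by
      have := Finset.sum_range_sub (fun i : ℕ => G ((U : ℝ) + i)) V
      simp only [Nat.cast_add, Nat.cast_one] at this
      simpa [add_assoc] using this
    rw [htel]; ring
  -- termwise bound
  have hterm : ∀ i ∈ Finset.range V,
      ‖(((U + 1 + i : ℕ) : ℂ)) ^ (-s) - (G ((U : ℝ) + i + 1) - G ((U : ℝ) + i))‖
        ≤ (2 + s.im) * (1 / ((U : ℝ) + i - 1) - 1 / ((U : ℝ) + i)) := by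
    intro i _
    have hN : (2 : ℝ) ≤ (U : ℝ) + i + 1 := by
      have : (0 : ℝ) ≤ i := by positivity
      linarith
    have h := norm_term_sub_G_le hσ0 hs1 hN
    have e1 : (((U + 1 + i : ℕ) : ℂ)) = (((U : ℝ) + i + 1 : ℝ) : ℂ) := by push_cast; ring
    have e2 : ((U : ℝ) + i + 1 - 1) = (U : ℝ) + i := by ring
    rw [e2] at h
    rw [e1]
    refine h.trans ?_
    -- ‖s‖ ≤ 2 + Im s and (U+i)^{-Re s-1} ≤ (U+i)^{-2} ≤ 1/((U+i-1)(U+i))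
    have hs_norm : ‖s‖ ≤ 2 + s.im := by
      have := Complex.norm_le_abs_re_add_abs_im s
      rw [abs_of_pos hσ0, abs_of_pos (by linarith)] at this
      linarith
    have hx1 : (1 : ℝ) < (U : ℝ) + i := by
      have : (0 : ℝ) ≤ i := by positivity
      linarith
    have hpow : ((U : ℝ) + i) ^ (-s.re - 1) ≤ 1 / ((U : ℝ) + i - 1) - 1 / ((U : ℝ) + i) := by
      calc ((U : ℝ) + i) ^ (-s.re - 1) ≤ ((U : ℝ) + i) ^ (-2 : ℝ) :=
            Real.rpow_le_rpow_of_exponent_le hx1.le (by linarith)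
        _ = 1 / ((U : ℝ) + i) ^ 2 := by
            rw [Real.rpow_neg (by linarith), one_div]
            norm_num
        _ ≤ 1 / ((U : ℝ) + i - 1) - 1 / ((U : ℝ) + i) := by
            rw [div_sub_div _ _ (by linarith) (by linarith), div_le_div_iff₀ (by positivity)
              (by nlinarith)]
            nlinarith
    have h0 : 0 ≤ ((U : ℝ) + i) ^ (-s.re - 1) := by positivity
    calc ‖s‖ * ((U : ℝ) + i) ^ (-s.re - 1) ≤ (2 + s.im) * ((U : ℝ) + i) ^ (-s.re - 1) :=
          mul_le_mul_of_nonneg_right hs_norm h0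
      _ ≤ (2 + s.im) * (1 / ((U : ℝ) + i - 1) - 1 / ((U : ℝ) + i)) :=
          mul_le_mul_of_nonneg_left hpow (by linarith)
  -- sum of the telescoping majorant
  have hmaj : ∑ i ∈ Finset.range V, (2 + s.im) * (1 / ((U : ℝ) + i - 1) - 1 / ((U : ℝ) + i))
      ≤ (2 + s.im) * (1 / ((U : ℝ) - 1)) := by
    rw [← Finset.mul_sum]
    apply mul_le_mul_of_nonneg_left _ (by linarith)
    have := Finset.sum_range_sub (fun i : ℕ => -(1 / ((U : ℝ) + i - 1))) V
    have e : ∀ i : ℕ, -(1 / ((U : ℝ) + ((i + 1 : ℕ) : ℝ) - 1)) - -(1 / ((U : ℝ) + i - 1))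
        = 1 / ((U : ℝ) + i - 1) - 1 / ((U : ℝ) + i) := by
      intro i; push_cast; ring
    simp only [e] at this
    rw [this]
    have hV0 : (0 : ℝ) ≤ V := by positivity
    have : 0 ≤ 1 / ((U : ℝ) + V - 1) := div_nonneg zero_le_one (by linarith)
    simp only [Nat.cast_zero, add_zero]
    linarith
  have hGU : ‖G U‖ ≤ 1 / s.im := by
    have := norm_G_le hσ1.le him (y := U) (by linarith)
    rwa [abs_of_pos (by linarith)] at this
  have hGV : ‖G ((U : ℝ) + V)‖ ≤ 1 / s.im := by
    have := norm_G_le hσ1.le him (y := (U : ℝ) + V) (by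
      have : (0 : ℝ) ≤ V := by positivity
      linarith)
    rwa [abs_of_pos (by linarith)] at this
  rw [hdecomp]
  calc _ ≤ ‖∑ i ∈ Finset.range V, ((((U + 1 + i : ℕ) : ℂ)) ^ (-s) - (G ((U : ℝ) + i + 1) - G ((U : ℝ) + i)))‖
        + ‖G ((U : ℝ) + V) - G U‖ := norm_add_le _ _
    _ ≤ (2 + s.im) * (1 / ((U : ℝ) - 1)) + (1 / s.im + 1 / s.im) := by
        apply add_le_add
        · exact ((norm_sum_le _ _).trans (Finset.sum_le_sum hterm)).trans hmaj
        · exact (norm_sub_le _ _).trans (add_le_add hGV hGU)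
    _ ≤ 4 / 3 + 1 := by
        apply add_le_add
        · rw [mul_one_div, div_le_div_iff₀ (by linarith) (by norm_num)]
          nlinarith
        · rw [← two_mul, mul_one_div, div_le_one (by linarith)]; linarith
    _ = 7 / 3 := by norm_num

/-- **The tail of the Dirichlet series**: for `1 < Re s ≤ 2`, `Im s ≥ 2` and `U ≥ 2 Im s`,
`‖ζ(s) - ∑_{n=1}^{U} n^{-s}‖ ≤ 3`. [folklore] -/
theorem norm_zeta_sub_sum_le (hσ1 : 1 < s.re) (hσ2 : s.re ≤ 2) (hu : 2 ≤ s.im) {U : ℕ}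
    (hU : 2 * s.im ≤ U) :
    ‖riemannZeta s - ∑ n ∈ Finset.Icc 1 U, (n : ℂ) ^ (-s)‖ ≤ 3 := by
  have hs0 : s ≠ 0 := by intro h; rw [h] at hσ1; simp at hσ1; linarith
  set f : ℕ → ℂ := fun n => 1 / (n : ℂ) ^ s with hf
  have hsum : Summable f := Complex.summable_one_div_nat_cpow.2 hσ1
  have hzeta : riemannZeta s = ∑' n, f n := zeta_eq_tsum_one_div_nat_cpow hσ1
  have hf' : ∀ n : ℕ, f n = (n : ℂ) ^ (-s) := by
    intro n; rw [hf]; simp only; rw [Complex.cpow_neg, one_div]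
  have hsplit := hsum.sum_add_tsum_nat_add (U + 1)
  -- the finite part equals `∑_{Icc 1 U} n^{-s}`
  have hfin : ∑ i ∈ Finset.range (U + 1), f i = ∑ n ∈ Finset.Icc 1 U, (n : ℂ) ^ (-s) := by
    have hf0 : f 0 = 0 := by rw [hf]; simp [Complex.zero_cpow hs0]
    rw [Finset.sum_range_succ', hf0, add_zero, ← Finset.Ico_add_one_right_eq_Icc,
      Finset.sum_Ico_eq_sum_range, Nat.add_sub_cancel]
    refine Finset.sum_congr rfl fun k _ => ?_
    rw [add_comm, hf']
  have htail : riemannZeta s - ∑ n ∈ Finset.Icc 1 U, (n : ℂ) ^ (-s) = ∑' i, f (i + (U + 1)) := by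
    rw [hzeta, ← hsplit, hfin]; ring
  rw [htail]
  -- bound the tail through its partial sums
  have hsum' : Summable fun i => f (i + (U + 1)) := (summable_nat_add_iff (U + 1)).2 hsum
  have hlim := hsum'.tendsto_sum_tsum_nat.norm
  refine le_of_tendsto' hlim fun V => ?_
  have e : ∑ i ∈ Finset.range V, f (i + (U + 1)) = ∑ i ∈ Finset.range V, (((U + 1 + i : ℕ) : ℂ)) ^ (-s) := by
    refine Finset.sum_congr rfl fun i _ => ?_
    rw [hf', show i + (U + 1) = U + 1 + i by ring]
  rw [e]
  exact (norm_tail_partial_le hσ1 hσ2 hu hU V).trans (by norm_num)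

end tail

/-! ### Assembly: `‖ζ(σ + iu)‖ ≤ log u / K + O_K(1)` -/

section assembly

open Complex

/-- `n^{-s} = n^{-σ} · e(D₀ n)` for `s = σ + iu`, `n ≥ 1`. [folklore] -/
theorem natCast_cpow_neg_eq (σ u : ℝ) {n : ℕ} (hn : 0 < n) :
    (n : ℂ) ^ (-((σ : ℂ) + u * I)) = (((n : ℝ) ^ (-σ) : ℝ) : ℂ) * e (phaseD u 0 n) := by
  rw [e_phaseD_zero u hn, neg_add, Complex.cpow_add _ _ (by exact_mod_cast hn.ne'),
    Complex.ofReal_cpow (Nat.cast_nonneg n)]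
  push_cast
  ring_nf

/-- Norm of `n^{-s}`: `‖n^{-s}‖ = n^{-σ} ≤ 1/n` for `σ ≥ 1`. [folklore] -/
theorem norm_natCast_cpow_neg_le {s : ℂ} (hσ : 1 ≤ s.re) {n : ℕ} (hn : 0 < n) :
    ‖(n : ℂ) ^ (-s)‖ ≤ 1 / n := by
  have hn0 : (0 : ℝ) < n := by exact_mod_cast hn
  rw [← Complex.ofReal_natCast, Complex.norm_cpow_eq_rpow_re_of_pos hn0, Complex.neg_re]
  calc (n : ℝ) ^ (-s.re) ≤ (n : ℝ) ^ (-1 : ℝ) :=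
        Real.rpow_le_rpow_of_exponent_le (by exact_mod_cast hn) (by linarith)
    _ = 1 / n := by rw [Real.rpow_neg hn0.le, Real.rpow_one, one_div]

/-- (Z1) The head: `‖∑_{1 ≤ n ≤ M} n^{-s}‖ ≤ 1 + log M`. [folklore] -/
theorem norm_head_le {s : ℂ} (hσ : 1 ≤ s.re) (M : ℕ) :
    ‖∑ n ∈ Finset.Ioc 0 M, (n : ℂ) ^ (-s)‖ ≤ 1 + Real.log M := by
  refine (norm_sum_le _ _).trans ?_
  have h1 : ∑ n ∈ Finset.Ioc 0 M, ‖(n : ℂ) ^ (-s)‖ ≤ ∑ n ∈ Finset.Ioc 0 M, (1 : ℝ) / n :=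
    Finset.sum_le_sum fun n hn => norm_natCast_cpow_neg_le hσ (Finset.mem_Ioc.1 hn).1
  refine h1.trans ?_
  have h2 : ∑ n ∈ Finset.Ioc 0 M, (1 : ℝ) / n = ((harmonic M : ℚ) : ℝ) := by
    rw [harmonic_eq_sum_Icc, ← Finset.Icc_add_one_left_eq_Ioc]
    push_cast; simp
  rw [h2]
  exact harmonic_le_one_add_log M

/-- (Z2) The Kusmin–Landau range: `‖∑_{⌊u⌋ < n ≤ 4(⌊u⌋+1)} n^{-s}‖ ≤ 24π` (`s = σ + iu`,
`σ ≥ 0`, `u ≥ 2`); more generally for any upper endpoint `x ≤ 4(⌊u⌋+1)`. [folklore] -/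
theorem norm_klrange_le {σ u : ℝ} (hσ : 0 ≤ σ) (hu : 2 ≤ u) {x : ℕ} (hx : x ≤ 4 * (⌊u⌋₊ + 1)) :
    ‖∑ n ∈ Finset.Ioc ⌊u⌋₊ x, (n : ℂ) ^ (-((σ : ℂ) + u * I))‖ ≤ 24 * π := by
  have hu0 : 0 ≤ u := by linarith
  rcases le_or_gt x ⌊u⌋₊ with hx0 | hx0
  · rw [Finset.Ioc_eq_empty (by omega), sum_empty, norm_zero]; positivity
  have hconv : ∀ y : ℕ, ∑ n ∈ Finset.Ioc ⌊u⌋₊ y, (n : ℂ) ^ (-((σ : ℂ) + u * I))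
      = ∑ n ∈ Finset.Ioc ⌊u⌋₊ y, (((n : ℝ) ^ (-σ) : ℝ) : ℂ) * e (phaseD u 0 n) := by
    intro y
    refine Finset.sum_congr rfl fun n hn => natCast_cpow_neg_eq σ u ?_
    have := (Finset.mem_Ioc.1 hn).1; omega
  rw [hconv]
  have hpart : ∀ y, ⌊u⌋₊ < y → y ≤ x → ‖∑ n ∈ Finset.Ioc ⌊u⌋₊ y, e (phaseD u 0 n)‖ ≤ 24 * π := by
    intro y hy1 hy2
    have h := kl_block hu (m := ⌊u⌋₊ + 1) (M := y) (by exact_mod_cast Nat.lt_floor_add_one u) (by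
      have h1 : (y : ℝ) ≤ 4 * ((⌊u⌋₊ : ℝ) + 1) := by exact_mod_cast hy2.trans hx
      have h2 : (⌊u⌋₊ : ℝ) ≤ u := Nat.floor_le hu0
      linarith)
    have e1 : ∑ n ∈ Finset.Icc ((⌊u⌋₊ + 1 : ℕ) : ℤ) y, e (phaseD u 0 n)
        = ∑ n ∈ Finset.Ioc ⌊u⌋₊ y, e (phaseD u 0 n) := by
      rw [sum_Icc_int_eq_nat, Finset.Icc_add_one_left_eq_Ioc]
      rfl
    push_cast at e1 h
    rw [e1] at h
    exact h
  have h := abel_bound_rpow (σ := σ) (fun n : ℕ => e (phaseD u 0 n)) hx0.le hσ (by positivity) hpart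
  refine h.trans ?_
  have h1 : ((⌊u⌋₊ : ℝ) + 1) ^ (-σ) ≤ 1 :=
    Real.rpow_le_one_of_one_le_of_nonpos (by linarith [Nat.cast_nonneg (α := ℝ) ⌊u⌋₊]) (by linarith)
  have h2 : (0 : ℝ) ≤ 24 * π := by positivity
  nlinarith

/-- (Z3) A dyadic block below `u`: if `‖∑_{N<n≤y} e(D₀ n)‖ ≤ B` for `N < y ≤ x ≤ 2N` then
`‖∑_{N<n≤x} n^{-s}‖ ≤ B / N` (`σ ≥ 1`). [folklore] -/
theorem norm_block_le {σ u : ℝ} (hσ : 1 ≤ σ) {N x : ℕ} (hN : 1 ≤ N) (hNx : N ≤ x) {B : ℝ}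
    (hB : 0 ≤ B) (hpart : ∀ y, N < y → y ≤ x → ‖∑ n ∈ Finset.Ioc N y, e (phaseD u 0 n)‖ ≤ B) :
    ‖∑ n ∈ Finset.Ioc N x, (n : ℂ) ^ (-((σ : ℂ) + u * I))‖ ≤ B / N := by
  have hconv : ∑ n ∈ Finset.Ioc N x, (n : ℂ) ^ (-((σ : ℂ) + u * I))
      = ∑ n ∈ Finset.Ioc N x, (((n : ℝ) ^ (-σ) : ℝ) : ℂ) * e (phaseD u 0 n) := by
    refine Finset.sum_congr rfl fun n hn => natCast_cpow_neg_eq σ u ?_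
    have := (Finset.mem_Ioc.1 hn).1; omega
  rw [hconv]
  have h := abel_bound_rpow (σ := σ) (fun n : ℕ => e (phaseD u 0 n)) hNx (by linarith) hB hpart
  refine h.trans ?_
  have hN0 : (0 : ℝ) < N := by exact_mod_cast hN
  have h1 : ((N : ℝ) + 1) ^ (-σ) ≤ 1 / N := by
    calc ((N : ℝ) + 1) ^ (-σ) ≤ ((N : ℝ) + 1) ^ (-1 : ℝ) :=
          Real.rpow_le_rpow_of_exponent_le (by linarith) (by linarith)
      _ = 1 / ((N : ℝ) + 1) := by rw [Real.rpow_neg (by linarith), Real.rpow_one, one_div]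
      _ ≤ 1 / N := one_div_le_one_div_of_le hN0 (by linarith)
  calc ((N : ℝ) + 1) ^ (-σ) * B ≤ 1 / N * B := mul_le_mul_of_nonneg_right h1 hB
    _ = B / N := by ring

/-- (Z4) The van der Corput range `(M, ⌊u⌋]` for `u ≥ 4^K`, `M = ⌊u^{1/K}⌋`. [folklore] -/
theorem norm_mid_le (K : ℕ) (hK : 1 ≤ K) :
    ∃ C : ℝ, 0 ≤ C ∧ ∀ σ u : ℝ, 1 ≤ σ → (4 : ℝ) ^ K ≤ u →
      ‖∑ n ∈ Finset.Ioc ⌊u ^ (1 / (K : ℝ))⌋₊ ⌊u⌋₊, (n : ℂ) ^ (-((σ : ℂ) + u * I))‖ ≤ C := by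
  obtain ⟨C₁, δ, hδ, hC₁, hPS⟩ := powerSaving (2 * K) (by omega)
  have hr0 : (0 : ℝ) ≤ (2 : ℝ) ^ (-δ) := by positivity
  have hr1 : (2 : ℝ) ^ (-δ) < 1 := Real.rpow_lt_one_of_one_lt_of_neg (by norm_num) (by linarith)
  refine ⟨C₁ * (1 - (2 : ℝ) ^ (-δ))⁻¹, by
    have : 0 < 1 - (2 : ℝ) ^ (-δ) := by linarith
    positivity, ?_⟩
  intro σ u hσ hu
  have hK0 : (0 : ℝ) < K := by exact_mod_cast hK
  have h4K : (4 : ℝ) ≤ (4 : ℝ) ^ K := by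
    calc (4 : ℝ) = 4 ^ 1 := (pow_one _).symm
      _ ≤ 4 ^ K := pow_le_pow_right₀ (by norm_num) hK
  have hu4 : 4 ≤ u := h4K.trans hu
  have hu0 : 0 < u := by linarith
  set r : ℝ := u ^ (1 / (K : ℝ)) with hr
  have hrK : r ^ (K : ℝ) = u := by
    rw [hr, ← Real.rpow_mul hu0.le]; field_simp; simp
  have hr4 : 4 ≤ r := by
    -- r^K = u ≥ 4^K
    refine le_of_not_gt fun h => ?_
    have h0 : 0 ≤ r := by positivity
    have : r ^ (K : ℝ) < (4 : ℝ) ^ (K : ℝ) := Real.rpow_lt_rpow h0 h hK0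
    rw [hrK, Real.rpow_natCast] at this
    linarith
  set M : ℕ := ⌊r⌋₊ with hM
  have hM1 : (M : ℝ) ≤ r := Nat.floor_le (by linarith)
  have hM2 : r < M + 1 := Nat.lt_floor_add_one r
  have hM3 : (3 : ℝ) ≤ M := by
    have : (3 : ℝ) < (M : ℝ) + 1 - 1 + 1 := by linarith
    have h3 : 3 ≤ M := by
      refine le_of_not_gt fun h' => ?_
      have : (M : ℝ) ≤ 2 := by exact_mod_cast Nat.lt_succ_iff.1 h'
      linarith
    exact_mod_cast h3
  have hMnat : 1 ≤ M := by
    have : (1 : ℝ) ≤ M := by linarith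
    exact_mod_cast this
  have hM0 : (0 : ℝ) < M := by linarith
  have hrM : r ≤ 2 * M := by linarith
  -- key: for N ≥ M, u ≤ N^{2K}
  have hkey : ∀ N : ℕ, M ≤ N → u ≤ (N : ℝ) ^ ((2 * K : ℕ) : ℝ) + 0 ∧ u ≤ (N : ℝ) ^ (((2 * K : ℕ) : ℝ) + 1 / 2) := by
    intro N hN
    have hN1 : (M : ℝ) ≤ N := by exact_mod_cast hN
    have hN0 : (1 : ℝ) ≤ N := by linarith
    have h1 : u ≤ (N : ℝ) ^ ((2 * K : ℕ) : ℝ) := by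
      -- u = r^K ≤ (2N)^K = 2^K N^K ≤ N^K N^K (as N ≥ M ≥ 3 ≥ 2)
      have h2 : r ^ (K : ℝ) ≤ (2 * (N : ℝ)) ^ (K : ℝ) :=
        Real.rpow_le_rpow (by linarith) (by linarith) hK0.le
      rw [hrK, Real.mul_rpow (by norm_num) (by linarith)] at h2
      have h3 : (2 : ℝ) ^ (K : ℝ) ≤ (N : ℝ) ^ (K : ℝ) := Real.rpow_le_rpow (by norm_num) (by linarith) hK0.le
      calc u ≤ (2 : ℝ) ^ (K : ℝ) * (N : ℝ) ^ (K : ℝ) := h2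
        _ ≤ (N : ℝ) ^ (K : ℝ) * (N : ℝ) ^ (K : ℝ) := mul_le_mul_of_nonneg_right h3 (by positivity)
        _ = (N : ℝ) ^ ((2 * K : ℕ) : ℝ) := by
            rw [← Real.rpow_add (by linarith)]; congr 1; push_cast; ring
    refine ⟨by linarith, h1.trans ?_⟩
    exact Real.rpow_le_rpow_of_exponent_le hN0 (by linarith)
  -- dyadic decomposition with G N = C₁ N^{-δ}
  set U₁ : ℕ := ⌊u⌋₊ with hU₁
  have hU₁u : (U₁ : ℝ) ≤ u := Nat.floor_le hu0.le
  set g : ℕ → ℂ := fun n => (n : ℂ) ^ (-((σ : ℂ) + u * I)) with hg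
  set G : ℕ → ℝ := fun N => C₁ * (N : ℝ) ^ (-δ) with hGdef
  have hG0 : ∀ N, 0 ≤ G N := fun N => by positivity
  have hblock : ∀ i : ℕ, M * 2 ^ i < U₁ →
      ‖∑ n ∈ Finset.Ioc (M * 2 ^ i) (min (M * 2 ^ (i + 1)) U₁), g n‖ ≤ G (M * 2 ^ i) := by
    intro i hi
    set N : ℕ := M * 2 ^ i with hN
    have hNM : M ≤ N := by rw [hN]; exact Nat.le_mul_of_pos_right _ (by positivity)
    have hN1 : 1 ≤ N := hMnat.trans hNM
    have hNr : (1 : ℝ) ≤ N := by exact_mod_cast hN1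
    have hNu : (N : ℝ) < u := lt_of_lt_of_le (by exact_mod_cast hi) hU₁u
    have hx : N ≤ min (M * 2 ^ (i + 1)) U₁ := le_min (by rw [hN, pow_succ]; nlinarith) hi.le
    have hx2 : min (M * 2 ^ (i + 1)) U₁ ≤ 2 * N := (min_le_left _ _).trans (by rw [hN]; ring_nf; exact le_rfl)
    have hpart : ∀ y, N < y → y ≤ min (M * 2 ^ (i + 1)) U₁ →
        ‖∑ n ∈ Finset.Ioc N y, e (phaseD u 0 n)‖ ≤ C₁ * (N : ℝ) ^ (1 - δ) := by
      intro y hy1 hy2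
      have h := hPS N hN1 u (by
        calc (N : ℝ) ^ (1 / 2 : ℝ) ≤ (N : ℝ) ^ (1 : ℝ) := Real.rpow_le_rpow_of_exponent_le hNr (by norm_num)
          _ = N := Real.rpow_one _
          _ ≤ u := hNu.le) (hkey N hNM).2 y hy1 (hy2.trans hx2)
      rwa [sum_Ioc_int_eq_nat] at h
    have hb := norm_block_le (u := u) hσ hN1 hx (by positivity) hpart
    refine hb.trans (le_of_eq ?_)
    have hN0 : (0 : ℝ) < N := by linarith
    rw [hGdef]; simp only
    rw [Real.rpow_sub hN0, Real.rpow_one, Real.rpow_neg hN0.le]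
    field_simp
  have hI : U₁ ≤ M * 2 ^ U₁ :=
    (Nat.lt_two_pow_self).le.trans (Nat.le_mul_of_pos_left _ (by omega))
  have hdy := dyadic_bound g G hG0 U₁ U₁ M hblock hI
  refine hdy.trans ?_
  -- ∑_{i<I} C₁ (M 2^i)^{-δ} ≤ C₁ ∑ (2^{-δ})^i ≤ C₁ / (1 - 2^{-δ})
  have hgeom := hasSum_geometric_of_lt_one hr0 hr1
  have hterm : ∀ i ∈ Finset.range U₁, G (M * 2 ^ i) ≤ C₁ * ((2 : ℝ) ^ (-δ)) ^ i := by
    intro i _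
    rw [hGdef]; simp only
    apply mul_le_mul_of_nonneg_left _ hC₁
    have e1 : ((M * 2 ^ i : ℕ) : ℝ) = (M : ℝ) * (2 : ℝ) ^ (i : ℝ) := by push_cast; rw [Real.rpow_natCast]
    rw [e1, Real.mul_rpow hM0.le (by positivity), ← Real.rpow_mul (by norm_num),
      show (i : ℝ) * -δ = -δ * i by ring, Real.rpow_mul (by norm_num), Real.rpow_natCast]
    have h1 : (M : ℝ) ^ (-δ) ≤ 1 := Real.rpow_le_one_of_one_le_of_nonpos (by linarith) (by linarith)
    have h2 : 0 ≤ ((2 : ℝ) ^ (-δ)) ^ i := by positivity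
    nlinarith
  calc ∑ i ∈ Finset.range U₁, G (M * 2 ^ i) ≤ ∑ i ∈ Finset.range U₁, C₁ * ((2 : ℝ) ^ (-δ)) ^ i :=
        Finset.sum_le_sum hterm
    _ = C₁ * ∑ i ∈ Finset.range U₁, ((2 : ℝ) ^ (-δ)) ^ i := by rw [Finset.mul_sum]
    _ ≤ C₁ * (1 - (2 : ℝ) ^ (-δ))⁻¹ := by
        apply mul_le_mul_of_nonneg_left _ hC₁
        exact sum_le_hasSum _ (fun i _ => by positivity) hgeom

/-- **`ζ(σ + iu) = o(log u)` uniformly for `1 < σ ≤ 2` (van der Corput):** for every `K ≥ 1`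
there is `C` with `‖ζ(σ + iu)‖ ≤ (log u)/K + C` for all `1 < σ ≤ 2`, `u ≥ 2`.
(Cf. Graham–Kolesnik Thm 2.14 `ζ(1+it) ≪ log t / log log t`; Titchmarsh Thm 5.16.) [folklore] -/
theorem norm_zeta_le_log_div (K : ℕ) (hK : 1 ≤ K) :
    ∃ C : ℝ, ∀ σ u : ℝ, 1 < σ → σ ≤ 2 → 2 ≤ u →
      ‖riemannZeta ((σ : ℂ) + u * I)‖ ≤ Real.log u / K + C := by
  obtain ⟨C₂, hC₂, hmid⟩ := norm_mid_le K hK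
  refine ⟨1 + (K : ℝ) * Real.log 4 + C₂ + 24 * π + 3, ?_⟩
  intro σ u hσ1 hσ2 hu
  have hK0 : (0 : ℝ) < K := by exact_mod_cast hK
  have hu0 : 0 < u := by linarith
  set s : ℂ := (σ : ℂ) + u * I with hs
  have hsre : s.re = σ := by simp [hs]
  have hsim : s.im = u := by simp [hs]
  set U₁ : ℕ := ⌊u⌋₊ with hU₁
  set U : ℕ := 4 * (U₁ + 1) with hU
  have hU₁u : (U₁ : ℝ) ≤ u := Nat.floor_le hu0.le
  have huU₁ : u < U₁ + 1 := Nat.lt_floor_add_one u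
  have hUu : 2 * s.im ≤ U := by
    rw [hsim, hU]; push_cast; linarith
  -- tail
  have htail : ‖riemannZeta s - ∑ n ∈ Finset.Icc 1 U, (n : ℂ) ^ (-s)‖ ≤ 3 :=
    norm_zeta_sub_sum_le (by rw [hsre]; exact hσ1) (by rw [hsre]; exact hσ2) (by rw [hsim]; exact hu) hUu
  -- generic three-way split for `1 ≤ M ≤ U₁`
  have hsplit : ∀ M : ℕ, M ≤ U₁ → ∑ n ∈ Finset.Icc 1 U, (n : ℂ) ^ (-s)
      = ∑ n ∈ Finset.Ioc 0 M, (n : ℂ) ^ (-s) + ∑ n ∈ Finset.Ioc M U₁, (n : ℂ) ^ (-s)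
        + ∑ n ∈ Finset.Ioc U₁ U, (n : ℂ) ^ (-s) := by
    intro M hM
    have hU₁U : U₁ ≤ U := by rw [hU]; omega
    have e : Finset.Icc 1 U = Finset.Ioc 0 U := (Finset.Icc_add_one_left_eq_Ioc 0 U)
    rw [e, ← Finset.sum_Ioc_consecutive _ (Nat.zero_le M) (hM.trans hU₁U),
      ← Finset.sum_Ioc_consecutive _ hM hU₁U, add_assoc]
  have hKL : ‖∑ n ∈ Finset.Ioc U₁ U, (n : ℂ) ^ (-s)‖ ≤ 24 * π :=
    norm_klrange_le (by linarith) hu le_rfl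
  have hlog4 : 0 < Real.log 4 := Real.log_pos (by norm_num)
  have hlogu : 0 ≤ Real.log u := Real.log_nonneg (by linarith)
  -- two cases
  rcases lt_or_ge u ((4 : ℝ) ^ K) with hsmall | hbig
  · -- small `u`: M = U₁, the middle range is empty
    have hhead : ‖∑ n ∈ Finset.Ioc 0 U₁, (n : ℂ) ^ (-s)‖ ≤ 1 + (K : ℝ) * Real.log 4 := by
      refine (norm_head_le (by rw [hsre]; exact hσ1.le) U₁).trans ?_
      have : Real.log U₁ ≤ (K : ℝ) * Real.log 4 := by
        rcases Nat.eq_zero_or_pos U₁ with h0 | h0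
        · rw [h0]; simp; positivity
        · rw [← Real.log_pow]
          apply Real.log_le_log (by exact_mod_cast h0)
          exact hU₁u.trans hsmall.le
      linarith
    have heq : riemannZeta s = ∑ n ∈ Finset.Ioc 0 U₁, (n : ℂ) ^ (-s)
        + ∑ n ∈ Finset.Ioc U₁ U, (n : ℂ) ^ (-s)
        + (riemannZeta s - ∑ n ∈ Finset.Icc 1 U, (n : ℂ) ^ (-s)) := by
      rw [hsplit U₁ le_rfl, Finset.Ioc_self, sum_empty, add_zero]; ring
    rw [heq]
    calc _ ≤ ‖∑ n ∈ Finset.Ioc 0 U₁, (n : ℂ) ^ (-s)‖ + ‖∑ n ∈ Finset.Ioc U₁ U, (n : ℂ) ^ (-s)‖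
          + ‖riemannZeta s - ∑ n ∈ Finset.Icc 1 U, (n : ℂ) ^ (-s)‖ := by
          refine (norm_add_le _ _).trans ?_
          gcongr
          exact norm_add_le _ _
      _ ≤ (1 + (K : ℝ) * Real.log 4) + 24 * π + 3 := add_le_add (add_le_add hhead hKL) htail
      _ ≤ Real.log u / K + (1 + (K : ℝ) * Real.log 4 + C₂ + 24 * π + 3) := by
          have : 0 ≤ Real.log u / K := by positivity
          linarith
  · -- large `u`: M = ⌊u^{1/K}⌋
    set M : ℕ := ⌊u ^ (1 / (K : ℝ))⌋₊ with hM
    have hr1 : 1 ≤ u ^ (1 / (K : ℝ)) := Real.one_le_rpow (by linarith) (by positivity)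
    have hMr : (M : ℝ) ≤ u ^ (1 / (K : ℝ)) := Nat.floor_le (by positivity)
    have hM1 : 1 ≤ M := (Nat.one_le_floor_iff _).2 hr1
    have hMU₁ : M ≤ U₁ := by
      apply Nat.floor_le_floor
      calc u ^ (1 / (K : ℝ)) ≤ u ^ (1 : ℝ) := by
            apply Real.rpow_le_rpow_of_exponent_le (by linarith)
            rw [div_le_one hK0]; exact_mod_cast hK
        _ = u := Real.rpow_one u
    have hhead : ‖∑ n ∈ Finset.Ioc 0 M, (n : ℂ) ^ (-s)‖ ≤ 1 + Real.log u / K := by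
      refine (norm_head_le (by rw [hsre]; exact hσ1.le) M).trans ?_
      have : Real.log M ≤ Real.log u / K := by
        calc Real.log M ≤ Real.log (u ^ (1 / (K : ℝ))) :=
              Real.log_le_log (by exact_mod_cast hM1) hMr
          _ = Real.log u / K := by rw [Real.log_rpow hu0]; ring
      linarith
    have hmid' := hmid σ u hσ1.le hbig
    have heq : riemannZeta s = ∑ n ∈ Finset.Ioc 0 M, (n : ℂ) ^ (-s)
        + ∑ n ∈ Finset.Ioc M U₁, (n : ℂ) ^ (-s)
        + ∑ n ∈ Finset.Ioc U₁ U, (n : ℂ) ^ (-s)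
        + (riemannZeta s - ∑ n ∈ Finset.Icc 1 U, (n : ℂ) ^ (-s)) := by
      rw [hsplit M hMU₁]; ring
    rw [heq]
    calc _ ≤ ‖∑ n ∈ Finset.Ioc 0 M, (n : ℂ) ^ (-s)‖ + ‖∑ n ∈ Finset.Ioc M U₁, (n : ℂ) ^ (-s)‖
          + ‖∑ n ∈ Finset.Ioc U₁ U, (n : ℂ) ^ (-s)‖
          + ‖riemannZeta s - ∑ n ∈ Finset.Icc 1 U, (n : ℂ) ^ (-s)‖ := by
          refine (norm_add_le _ _).trans ?_
          gcongr
          refine (norm_add_le _ _).trans ?_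
          gcongr
          exact norm_add_le _ _
      _ ≤ (1 + Real.log u / K) + C₂ + 24 * π + 3 :=
          add_le_add (add_le_add (add_le_add hhead hmid') hKL) htail
      _ ≤ Real.log u / K + (1 + (K : ℝ) * Real.log 4 + C₂ + 24 * π + 3) := by
          have : 0 ≤ (K : ℝ) * Real.log 4 := by positivity
          linarith

/-- The same bound for `|u| ≥ 2` (conjugation symmetry `ζ(s̄) = conj ζ(s)`). [folklore] -/
theorem norm_zeta_le_log_div_abs (K : ℕ) (hK : 1 ≤ K) :
    ∃ C : ℝ, ∀ σ u : ℝ, 1 < σ → σ ≤ 2 → 2 ≤ |u| →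
      ‖riemannZeta ((σ : ℂ) + u * I)‖ ≤ Real.log |u| / K + C := by
  obtain ⟨C, hC⟩ := norm_zeta_le_log_div K hK
  refine ⟨C, fun σ u hσ1 hσ2 hu => ?_⟩
  rcases le_or_gt 0 u with hu0 | hu0
  · rw [abs_of_nonneg hu0] at hu ⊢
    exact hC σ u hσ1 hσ2 hu
  · rw [abs_of_neg hu0] at hu ⊢
    have h := hC σ (-u) hσ1 hσ2 hu
    have : (σ : ℂ) + u * I = starRingEnd ℂ ((σ : ℂ) + (-u : ℝ) * I) := by
      apply Complex.ext <;> simp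
    rw [this, riemannZeta_conj, Complex.norm_conj]
    exact_mod_cast h

end assembly

end VdC
end Literature.NumberTheory.LFunctions
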